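import Literature.MathematicalPhysics.QuantumFieldTheory.Balaban1983to89.B4Ineq19ZeroBoxEta

/-!
# `Balaban1983to89.B4Ineq19ZeroBoxFace` — B4 «Theorem (Proposition 2.1 of [1])», clauses (1.9)–(1.10) IN THE CELL'S
# TYPED FORM `B4.Ineq19_110`, PROVED at `A = 0` on b04's VERBATIM zero-field carrier `zeroFieldSettingB` (UNGUARDED
# Hölder field) over the ZERO-FIELD BOX FAMILY (every scale `k ≥ 1`, every box, every mass `m² ∈ [0, m²₊]`), by ONE
# REFLECTION in the far face — the first step of the print's «multiple reflection method» (2.42): Hölder continuity of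
# `D_μG_k(□,0)f` UP TO THE FACE where the Neumann condition makes it vanish; and the (1.9)–(1.10) half of the typed leaf
# for `0 ≤ α < 1` (`ThmPrinted19NN`, node 12) on that carrier, including b04's default `zeroFieldSetting`

**Source.** T. Bałaban, *Regularity and Decay of Lattice Green's Functions*, Commun. Math. Phys. **89**, 571–597 (1983)
(bib key `Balaban1983RegularityDecay`, «B4» of the 1983–89 series): p. 572 [PDF 2] (1.3), (1.6), p. 573 [PDF 3] the
Theorem with (1.9)–(1.10) and its last sentence on rectangular parallelepipeds, p. 584 [PDF 14] the image representation
(2.42) (journal page = PDF page + 570; renders `b2b-balaban-ref1/pages/1983-cmp89-regularity-decay/1983-cmp89-regularity-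
decay-p003-x2.png`, `-p014-x2.png`, read as images; cell transcript `b2b-balaban-b04/transcript-B4.md`).  A new leaf on
top of `B4Ineq19ZeroBoxEta` (pv17 node 12: the box family `boxFam`/`boxFamB`, the member type `BoxInst`, the typed
(1.9)–(1.10) in the BOND convention, `lhs19_bound`, `valDG_bound`, `valG_bound`, `ThmPrinted19NN`; through it
`B4Thm19ZeroBoxHolder` node 10, `thm19_zero_box_holder_value_coeff`, USED HERE A SECOND TIME on the DOUBLED box) and of
`B4Cor23ZeroEta` (b04: the concrete carrier `ZeroFieldInstance` / `zeroFieldSettingB` / `zeroFieldSetting`, USED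
READ-ONLY), `B4BoxCov237` (`boxOpR`), `B4Reflection242` (`boxDom`, `neumannLapK`, `avgK`, `blk`), `B4Lower18`
(`fineOpR_isUnit`, `fineOpR_boxDom`, `edistR`).  The typed statement `B4.Ineq19_110` is the cell's (`B4.lean`, b04) and
is USED BY NAME, never restated.  No existing module is touched; nothing of B4 is asserted as a fact.

## WHAT IS PRINTED (verbatim; `≦` of the print written `≤`)

p. 573: «**Theorem** (Proposition 2.1 of [1]). For α < 1 there exist positive constants δ₀, c₀, R₀ independent of
A, k, Ω and depending on d, M only, c₀ on α also, such that for e sufficiently small and for an arbitrary function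
f : Ω → R^N, we have
|x − x′|^{−α} |U(A(Γ_{x,x′}))(D^η_{A,μ}G_k(Ω, A)f)(x′) − (D^η_{A,μ}G_k(Ω, A)f)(x)| ≤ c₀ exp(−δ₀ dist({x, x′}, supp f))‖f‖_∞   (1.9)
for x, x′ ∈ Ω, and satisfying the condition dist({x, x′}, Ω^c) ≥ R₀. Similarly
|(D^η_{A,μ}G_k(Ω, A)f)(x)|, |(G_k(Ω, A)(x)| ≤ c₀ exp(−δ₀ dist(x, supp f))‖f‖_∞   (1.10)
for x ∈ Ω, dist(x, Ω^c) ≥ R₀.» ⟦sic: «(G_k(Ω, A)(x)» — read `(G_k(Ω, A)f)(x)`⟧ […] «For some simple sets Ω, e.g. for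
rectangular parallelepipeds, the inequalities hold without any restrictions on the points x, x′, i.e. for all x, x′ ∈ Ω.»

p. 584: «This part of the argument is valid for an arbitrary rectangular parallelepiped □ built of unit blocks, so the
inequalities are valid for all such sets. Let us denote ξ = L^{−j}. We represent G_j(□) with the help of the propagator
G_j with free boundary conditions on ξZ^d using the multiple reflection method. If □ is written as
□ = {x ∈ ξZ^d : 0 ≤ x_μ ≤ M_μ, μ = 1,…,d}, then
G_j(□; x,x′) = G_j(x,x′) + Σ_μ G_j(x,(x′₁,…,−x′_μ−ξ,…,x′_d)) + Σ_μ G_j(x,(x′₁,…,2M_μ−ξ−x′_μ,…,x′_d)) + … .   (2.42)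
Using this representation it is enough to prove (2.35), (2.36) for the propagator G_j.»

## WHAT THIS FILE CERTIFIES (kernel-checked, zero `sorry`, no hypotheses; the lineage and b04's carrier are USED BY NAME)

Fix a dimension `d + 1`, `L = ℓ + 1 ≥ 2`, the coefficient `a > 0` of `aP_k` in (1.6), a mass ceiling `m²₊`, a big-block
size `Mb` and a boundary-distance assignment `g` (node 12's parameters; `Mb`, `g` enter only fields (1.9)–(1.10) do not
read).  `boxFamB ℓ m²₊ a Mb g i = zeroFieldSettingB a Mb g i.toZF` (node 12) is b04's carrier VERBATIM on the member
`i : BoxInst d ℓ m²₊` (scale `k ≥ 1`, box `□ = Π_μ[0, M_μ)` of unit blocks, `Ω₀ ⊇ □`, mass `m² ∈ [0, m²₊]`, charge `e`);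
its Hölder field is the UNGUARDED quotient
`lhs19 α μ f x x′ = |x − x′|_η^{−α}·|fdiff(G f)(x′) − fdiff(G f)(x)|` for ALL `x, x′ ∈ □`, where b04's
`fdiff = D^η_{0,μ}` is `η^{-1}((G f)(x + ηe_μ) − (G f)(x))` on a bond of `□` and `0` at a point whose `μ`-bond leaves `□`.
* `ineq19_110_boxFamB` (§5) — **THE CELL'S TYPED (1.9)–(1.10) `B4.Ineq19_110` AT `A = 0` ON b04's VERBATIM CARRIER, EVERY
  BOX, EVERY SCALE**: for every `0 ≤ α < 1` there are `δ₀ > 0`, `c₀ > 0` (depending on `d, ℓ, a, m²₊, α`; «independent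
  of A, k, Ω») with `∀ R₀ i, Ineq19_110 (boxFamB ℓ m²₊ a Mb g i) α δ₀ c₀ R₀` — i.e. (`B4Ineq19ZeroBoxEta.ineq19_110_B_iff`,
  `Iff.rfl`) for every member, direction `μ`, source `f` and ALL points `x, x′` of the box the three printed inequalities,
  the first with b04's unguarded field; the typed antecedent `rect ∨ R₀ ≤ dist(·, Ω₀∖Ω)` is not used;
* `lhs19B_bound` (§4) — the (1.9) clause alone, unguarded: pairs of bonds — node 12 (`lhs19_bound`, from node 10); one
  bond and one point `x′` whose bond leaves `□` — `x′` lies on the last `μ`-layer (`last_layer_of_not_mem`), at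
  sup-distance `≥ j :=` the number of layers from the bond start to that layer (`layer_dist_le_supNorm`), and the weight
  `(ηj)^{−α}` is absorbed by the FACE BOUND; no bond — `0`;
* `fdiff_face_bound` (§3) — **HÖLDER CONTINUITY OF `D_μG_k(□,0)f` UP TO THE FAR `μ`-FACE**: one pair `(δ₀, c₀)` with
  `|(D_μG_k(□,0)f)(x)| ≤ c₀·(ηj)^α·e^{−δ₀dist_η(x, supp f)}‖f‖_∞` for every member and every bond `⟨x, x + ηe_μ⟩ ⊂ □`,
  `j = L^kM_μ − 1 − x_μ ≥ 1` — from node 10's (1.9) on the DOUBLED box through the reflection (below);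
* `green_fold` (§2) — **THE ONE-REFLECTION CASE OF (2.42) ON THE LATTICE**: `G_k(□₂,0)(f∘fold) = (G_k(□,0)f)∘fold` for the
  box `□₂` doubled across the far `μ`-face (`boxOpR_mulVec_fold`: the same for the operators; `ker_refl`: reflection
  symmetry of `−Δ^N_{□₂} + m² + aQ*Q`; `ker_fold`: the folded-kernel identity on `□`);
* `thmPrinted19NN_boxFamB`, `thmPrinted19NN_zeroFieldSetting` (§5) — node 12's leaf half `ThmPrinted19NN` (the typed
  `B4.ThmPrinted` with conclusion `Ineq19_110` and `0 ≤ α < 1`) HOLDS on `boxFamB` and on b04's DEFAULT carrier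
  `fun i => zeroFieldSetting a Mb i.toZF` (no field re-read at all), `R₀ = e₁ = 1`, antecedents unused;
  `ineq19_110_boxFam_and_boxFamB`: common constants for node 12's bond-convention family and b04's verbatim one;
* §6: NON-VACUITY — at every scale `k ≥ 1` a member meets all four typed antecedents (`cube_hypothesesB`,
  `threshold_metB`); the statements are instantiated at `d + 1 = 4`, `L = 2`, `a = m²₊ = 1`, `Mb = 5`, `α = 1/2`.

## THE REFLECTION (the mathematics certified in §1–§3; lattice units, `n = L^k`, `η = 1/n`)

`□ = Π_i[0, nM_i) ∩ ℤ^{d+1}` (`boxDom (n·M)`), `□₂ = boxDom (n·dbl M μ)` the box with `M_μ` replaced by `2M_μ`,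
`r(y) = (…, 2nM_μ − 1 − y_μ, …)` the reflection in the hyperplane `y_μ = nM_μ − ½` (which lies BETWEEN unit blocks and
bisects exactly the bonds `⟨y, y + e_μ⟩` leaving `□`), `fold = id` on `□`, `= r` on `□₂∖□`.  (R1) The kernel
`K_N(x,y) = n²(−Δ^N_{boxDom N})(x,y) + m²δ_{xy} + (a/n^{d+1})1_{blk x = blk y}` of `boxOpR` (`B4BoxCov237.opBoxR`, (2.44))
satisfies `K_{□₂}(r t, r y) = K_{□₂}(t, y)` (`r` maps `n`-blocks to `n`-blocks and neighbours to neighbours) and, for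
`t ∈ □`, `Σ_{y∈□₂} K_{□₂}(t,y)u(fold y) = Σ_{w∈□} K_□(t,w)u(w)` (the only `y ∈ □₂∖□` adjacent to `t` is `r t` across the
face, where `u(fold(r t)) = u(t)` reproduces the Neumann row of `□`; the degree terms agree because `□₂` has exactly one
more neighbour there); hence `A_{□₂}(u∘fold) = (A_□u)∘fold` and, both being invertible (`a > 0`, `m² ≥ 0`),
`G_{□₂}(f∘fold) = (G_□f)∘fold`.  (H) For a bond `⟨x, x+e_μ⟩ ⊂ □` the mirror pair `⟨r(x+e_μ), r x⟩` is a bond of `□₂`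
(`r x = r(x+e_μ) + e_μ`) with `G_{□₂}(f∘fold)` taking the values `(G_□f)(x+e_μ), (G_□f)(x)` at its ends, so the
(1.9)-difference of the two bond derivatives is `−2(D_μG_□f)(x)` at sup-distance `|r(x+e_μ) − x|_∞ = 2j`,
`j = nM_μ − 1 − x_μ ≥ 1`; node 10 on `□₂` (its constants are uniform in the side lengths, so the SAME `(δ₀, c₀)` serve
`□` and `□₂`), with `|f∘fold| ≤ ‖f‖_∞` and `dist(mirror pair, supp(f∘fold)) ≥ dist(x, supp f) − η`
(`supNorm_sub_fold_le`, `supNorm_sub_fold_le_refl`: `|x − fold z|_∞ ≤ |x − z|_∞` and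
`|x − fold z|_∞ ≤ |r(x+e_μ) − z|_∞ + 1` for `z ∈ □₂`), gives
`(n/2j)^α·2|(D_μG_□f)(x)| ≤ c₀e^{−δ₀(n·s−1)/n}‖f‖_∞`, `s = dist_η(x, supp f)`, i.e. the face bound with `c₀e^{δ₀}` and
`(j/n)^α` (using `(1/2)^α ≥ 1/2`).  (C) If `x′ ∈ □` has no `μ`-bond in `□` then `x′_μ = nM_μ − 1`, `|x − x′|_∞ ≥ j`, and
`(η|x − x′|_∞)^{−α}·|(D_μG_□f)(x) − 0| ≤ (ηj)^{−α}·c(ηj)^α e^{−δs}‖f‖_∞`, with `dist_η({x,x′}, supp f) ≤ s`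
(`setDist_mono_left`).

## DICTIONARY (typist's; each line is a reading, not a quotation; everything at `A = 0`, `U ≡ 1`, one component; the
dictionaries of `B4Cor23ZeroEta` (carrier), `B4Ineq19ZeroBoxEta` (family) and `B4Thm19ZeroBoxHolder` (box theorem) apply)

* `Ω = □` a rectangular parallelepiped of unit blocks at mesh `η = L^{-k}` ↦ the member's fine point set
  `R = boxDom (L^k·M) = Π_μ[0, L^kM_μ) ∩ ℤ^{d+1}`, `n = L^k` (node 12's `BoxInst.toZF`); `G_k(□, 0)` ↦ b04's
  `ZeroFieldInstance.green a = (fineOpR n a m² R)⁻¹ = (boxOpR L^k a m² M)⁻¹` (`BoxInst.green_eq`).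
* the print's `□ = {0 ≤ x_μ ≤ M_μ}` with images `x′_μ ↦ −x′_μ − ξ` and `x′_μ ↦ 2M_μ − ξ − x′_μ` (reflections in the
  hyperplanes `x_μ = −ξ/2` and `x_μ = M_μ − ξ/2`, half a mesh OUTSIDE the closed box, between unit blocks) ↦ in lattice
  units with the half-open box `[0, nM_μ)`: the far image `y_μ ↦ 2nM_μ − 1 − y_μ` (`refl`), mirror `y_μ = nM_μ − ½`; only
  this ONE image is used (the near face `x_μ = 0` is where b04's forward difference needs no reflection: a point with
  `x_μ = 0` has its `μ`-bond inside `□`), and only the FIRST term of the image series: instead of the free propagator on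
  `ξℤ^d` and all images, the NEUMANN propagator of the doubled box `□₂` and one image — an exact finite identity
  (`green_fold`), to which node 10 (the print's (1.9) on boxes, kernel-proved there) applies on `□₂`.
* `D^η_{0,μ}ψ(x)` ↦ b04's `B4Cor23Zero.fdiff n R μ ψ x` (`= L^k(ψ(x + e_μ) − ψ(x))` on a bond, `0` on a non-bond); the left
  side of (1.9) ↦ b04's field `lhs19` VERBATIM (unguarded product, `|x − x′|_η = edistR = η|x − x′|_∞`; `x = x′` gives
  `0^{−α}·0 = 0` in Lean); `dist({x,x′}, supp f)`, `dist(x, supp f)`, `‖f‖_∞` ↦ b04's `sdist2`, `sdist1`, `supN`.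
* «δ₀, c₀, R₀ independent of A, k, Ω … c₀ on α also … for e sufficiently small» ↦ as in node 12: `δ₀, c₀` depend on
  `d, ℓ, a, m²₊` and both on `α`, uniform in the member; `R₀`, `e₁` free.
* `0 ≤ α < 1` ↦ the binders `(hα0 : 0 ≤ α) (hα1 : α < 1)` (node 12, OBSERVATION (O-α)).

## OBSERVATIONS surfaced by the binding (for b04 / the carver; the first is now PARTLY certified)

(O-bond, update of node 12's) b04's unguarded Hölder field pairs, at a far face of `□`, a genuine bond derivative
`(D_μG_k(□,0)f)(x)` with the artificial `0` of a non-bond at `η`-distance `≥ ηj`, weight `≤ (ηj)^{−α}`.  FOR `G_k(□, 0)`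
ON A BOX THIS IS HARMLESS — certified here: the derivative is itself `O((ηj)^α)` small near the face (`fdiff_face_bound`,
the Neumann condition read through the reflection), so b04's verbatim `Ineq19_110` holds on the box family with NO
re-reading of any field (`ineq19_110_boxFamB`).  For `δG_k(Ω,Ω₀,0)` at a face of `Ω` interior to `Ω₀` (the typed (1.11),
field `dlhs19`) it is NOT harmless (node 12/13, (O-bond)): there the outer Green's function has a derivative of order
`‖f‖_∞` across the face and no reflection symmetry — the typed (1.11) with the unguarded field fails on nested boxes,
which is why node 13 binds (1.11)–(1.12) in the bond convention only; this file does not change that.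
(O-α) unchanged (node 12): the literal leaf's `α < 0` instances are false on any faithful family; `0 ≤ α` throughout.

## HONEST SCOPE — what is NOT certified here

(i) Only `A = 0` (`U ≡ 1`), one component.  (ii) Only boxes `□ = Π_μ[0, M_μ)` of unit blocks at the origin (node 12's
family); general big-block unions `Ω` with `dist(·, Ω^c) ≥ R₀` are NOT treated.  (iii) Only (1.9)–(1.10) = `Ineq19_110`;
b04's verbatim (1.11) (`dlhs19` unguarded) is false on nested boxes ((O-bond)) and is not touched; the bond-convention
(1.11)–(1.12) are node 13's (`B4Ineq111ZeroNestEta`, whose members are node 12's `BoxInst` up to `NestInst.toBox`, so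
`ineq19_110_boxFamB` applies to `nestFamB … i = zeroFieldSettingB a Mb g i.toBox.toZF` by `fun R₀ i => h R₀ i.toBox` — not
restated here to keep this leaf independent of node 13).  (iv) ONE reflection in ONE face per direction, not the print's
full image series (2.42) over the free propagator (`B4Reflection242` types that route; its Hölder hypotheses on the free
propagator are not discharged in the lineage) — enough for the face behaviour of `D_μG_k(□,0)`, which is all (1.9) on a
box needs beyond node 10.  (v) Mesh `η = L^{-k}`, `k ≥ 1`, `L ≥ 2`; constants existential, depending on `d, ℓ, a, m²₊, α`
(the face bound costs a factor `e^{δ₀}` and the merge takes `min δ`, `max c`); distances `η`-scaled sup-distances.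
(vi) This file does not touch `B4.lean`, `B4Cor23ZeroEta.lean` (b04's), node 12/13's files, `DagBinding`/`DagDischarged`
(the carver's); whether the binding reads (1.9)–(1.10) through `boxFamB`/`zeroFieldSetting` is b04's / the carver's call.

**Value = kernel certificate (the cell's typed (1.9)–(1.10) at `A = 0` on b04's verbatim zero-field carrier over the box
family, all scales, all `0 ≤ α < 1`; the lattice one-reflection identity for the Neumann box Green's function), NOT
summit progress**: the Yang–Mills / `Summit.QuantumFields` statements are untouched; no Literature fact is minted — every
hypothesis used is kernel-proved in this package.
-/

namespace Literature.MathematicalPhysics.QuantumFieldTheory.Balaban1983to89.B4Ineq19ZeroBoxFace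

open Finset Matrix
open Literature.MathematicalPhysics.QuantumFieldTheory.Balaban1983to89.B4 (EtaSetting Ineq19_110 Ineq111_112
  ThmPrinted)
open Literature.MathematicalPhysics.QuantumFieldTheory.Balaban1983to89.B4ContourShift (supNorm supNorm_nonneg
  abs_le_supNorm)
open Literature.MathematicalPhysics.QuantumFieldTheory.Balaban1983to89.B4Reflection242 (boxDom mem_boxDom blk diagK
  avgK nbrs mem_nbrs neumannLapK mem_nbrs_iff_sub sflip unitVec_sflip_iff neg_one_sub_ediv supNorm_le_of_forall)
open Literature.MathematicalPhysics.QuantumFieldTheory.Balaban1983to89.B4BoxCov237 (opBoxR boxOpR uvec)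
open Literature.MathematicalPhysics.QuantumFieldTheory.Balaban1983to89.B4Lower18 (fineOpR fineOpR_boxDom
  IsBlockUnion boxDom_isBlockUnion edistR fineOpR_isUnit)
open Literature.MathematicalPhysics.QuantumFieldTheory.Balaban1983to89.B4TwoRegion120 (supNorm_sub_comm)
open Literature.MathematicalPhysics.QuantumFieldTheory.Balaban1983to89.B4Cor23Zero (fdiff fdiff_of_mem
  fdiff_of_not_mem supp edistR_nonneg)
open Literature.MathematicalPhysics.QuantumFieldTheory.Balaban1983to89.B4Cor23ZeroDelta (setDist setDist_le
  mem_supp bdist)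
open Literature.MathematicalPhysics.QuantumFieldTheory.Balaban1983to89.B4Cor23ZeroEta (ZeroFieldInstance
  zeroFieldSettingB zeroFieldSetting)
open Literature.MathematicalPhysics.QuantumFieldTheory.Balaban1983to89.B4Thm19ZeroBoxHolder
  (thm19_zero_box_holder_value_coeff)
open Literature.MathematicalPhysics.QuantumFieldTheory.Balaban1983to89.B4Ineq19ZeroBoxEta (holderQ holderQ_of_bond
  holderQ_of_not_bond zeroFieldSettingBond bond_lhs19_eq_of_bond ineq19_110_bond_iff ineq19_110_B_iff abs_le_supN
  supN_nonneg BoxInst boxFam boxFamB ineq19_110_boxFam lhs19_bound Lk_pos D1_le transfer setDist_edistR_nonneg nbr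
  nbr_val fdiff_eq edistR_rpow_neg rhs_nonneg ThmPrinted19NN thmPrinted19NN_of_thmPrinted)

noncomputable section

variable {d : ℕ}

/-! ## §1 The box doubled across its far `μ`-face, the reflection and the fold -/

section Geometry

variable (n : ℕ) (M : Fin (d + 1) → ℕ) (μ : Fin (d + 1))

/-- the box of unit blocks DOUBLED in direction `μ`: `Π_{i≠μ}[0, M_i) × [0, 2M_μ)` (block units). [folklore] -/
def dbl : Fin (d + 1) → ℕ := Function.update M μ (2 * M μ)

/-- **THE REFLECTION IN THE FAR `μ`-FACE** of the fine box `Π_i[0, nM_i)`: `y_μ ↦ 2nM_μ − 1 − y_μ` (the mirror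
hyperplane `y_μ = nM_μ − ½` bisects the bonds `⟨y, y + e_μ⟩`, `y_μ = nM_μ − 1`, leaving the box); other coordinates
fixed.  [cite: Balaban1983RegularityDecay, p. 584 (2.42) «multiple reflection method», one reflection, dictionary] -/
def refl (y : Fin (d + 1) → ℤ) : Fin (d + 1) → ℤ :=
  Function.update y μ (2 * ((n : ℤ) * (M μ : ℤ)) - 1 - y μ)

/-- **THE FOLD** of the doubled fine box onto the box: identity on the box, the reflection on the mirror half.
[cite: Balaban1983RegularityDecay, p. 584 (2.42), dictionary] -/
def fold (y : Fin (d + 1) → ℤ) : Fin (d + 1) → ℤ :=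
  if y μ < (n : ℤ) * (M μ : ℤ) then y else refl n M μ y

variable {n M μ}

/-- the doubled side. [folklore] -/
theorem dbl_same : dbl M μ μ = 2 * M μ := by
  simp [dbl]

/-- the other sides are unchanged. [folklore] -/
theorem dbl_ne {i : Fin (d + 1)} (h : i ≠ μ) : dbl M μ i = M i := by
  simp [dbl, h]

/-- the reflected `μ`-coordinate. [folklore] -/
@[simp] theorem refl_apply_same (y : Fin (d + 1) → ℤ) :
    refl n M μ y μ = 2 * ((n : ℤ) * (M μ : ℤ)) - 1 - y μ := by
  simp [refl]

/-- the reflection fixes the coordinates `≠ μ`. [folklore] -/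
@[simp] theorem refl_apply_ne (y : Fin (d + 1) → ℤ) {i : Fin (d + 1)} (h : i ≠ μ) : refl n M μ y i = y i := by
  simp [refl, h]

/-- the reflection is an involution. [folklore] -/
@[simp] theorem refl_refl (y : Fin (d + 1) → ℤ) : refl n M μ (refl n M μ y) = y := by
  funext i
  by_cases h : i = μ
  · subst h; rw [refl_apply_same, refl_apply_same]; ring
  · rw [refl_apply_ne _ h, refl_apply_ne _ h]

/-- the reflection is injective. [folklore] -/
theorem refl_injective : Function.Injective (refl n M μ : (Fin (d + 1) → ℤ) → _) := fun y y' h => by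
  rw [← refl_refl (n := n) (M := M) (μ := μ) y, h, refl_refl]

/-- membership in the fine box, coordinatewise. [folklore] -/
theorem mem_box_iff {y : Fin (d + 1) → ℤ} :
    y ∈ boxDom (fun i => n * M i) ↔ ∀ i, 0 ≤ y i ∧ y i < (n : ℤ) * (M i : ℤ) := by
  rw [mem_boxDom]
  simp only [Nat.cast_mul]

/-- membership in the doubled fine box, coordinatewise. [folklore] -/
theorem mem_dbl_iff {y : Fin (d + 1) → ℤ} :
    y ∈ boxDom (fun i => n * dbl M μ i) ↔
      (∀ i, i ≠ μ → 0 ≤ y i ∧ y i < (n : ℤ) * (M i : ℤ)) ∧ (0 ≤ y μ ∧ y μ < 2 * ((n : ℤ) * (M μ : ℤ))) := by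
  rw [mem_boxDom]
  constructor
  · intro h
    refine ⟨fun i hi => ?_, ?_⟩
    · have := h i
      rwa [dbl_ne hi, Nat.cast_mul] at this
    · have := h μ
      rw [dbl_same] at this
      push_cast at this
      constructor
      · exact this.1
      · linarith [this.2]
  · rintro ⟨h1, h2⟩ i
    by_cases hi : i = μ
    · subst hi
      rw [dbl_same]
      push_cast
      exact ⟨h2.1, by linarith [h2.2]⟩
    · rw [dbl_ne hi, Nat.cast_mul]
      exact h1 i hi

/-- the box is the first half of the doubled box. [folklore] -/
theorem mem_dbl_of_mem {y : Fin (d + 1) → ℤ} (hy : y ∈ boxDom (fun i => n * M i)) :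
    y ∈ boxDom (fun i => n * dbl M μ i) := by
  rw [mem_box_iff] at hy
  rw [mem_dbl_iff]
  refine ⟨fun i _ => hy i, (hy μ).1, ?_⟩
  nlinarith [(hy μ).1, (hy μ).2]

/-- the reflection maps the doubled box onto itself. [folklore] -/
theorem refl_mem_dbl {y : Fin (d + 1) → ℤ} (hy : y ∈ boxDom (fun i => n * dbl M μ i)) :
    refl n M μ y ∈ boxDom (fun i => n * dbl M μ i) := by
  rw [mem_dbl_iff] at hy ⊢
  refine ⟨fun i hi => ?_, ?_⟩
  · rw [refl_apply_ne _ hi]; exact hy.1 i hi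
  · rw [refl_apply_same]
    constructor <;> linarith [hy.2.1, hy.2.2]

/-- … and the box into the mirror half. [folklore] -/
theorem refl_mem_dbl_of_mem {y : Fin (d + 1) → ℤ} (hy : y ∈ boxDom (fun i => n * M i)) :
    refl n M μ y ∈ boxDom (fun i => n * dbl M μ i) :=
  refl_mem_dbl (mem_dbl_of_mem hy)

/-- a box point has `y_μ < nM_μ`. [folklore] -/
theorem lt_of_mem {y : Fin (d + 1) → ℤ} (hy : y ∈ boxDom (fun i => n * M i)) : y μ < (n : ℤ) * (M μ : ℤ) :=
  ((mem_box_iff.1 hy) μ).2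

/-- the mirror image of a box point has `nM_μ ≤ (refl y)_μ`. [folklore] -/
theorem le_refl_of_mem {y : Fin (d + 1) → ℤ} (hy : y ∈ boxDom (fun i => n * M i)) :
    (n : ℤ) * (M μ : ℤ) ≤ refl n M μ y μ := by
  rw [refl_apply_same]
  have := (mem_box_iff.1 hy) μ
  linarith [this.1, this.2]

/-- the fold is the identity on the first half. [folklore] -/
theorem fold_of_lt {y : Fin (d + 1) → ℤ} (h : y μ < (n : ℤ) * (M μ : ℤ)) : fold n M μ y = y := by
  rw [fold, if_pos h]

/-- the fold is the reflection on the mirror half. [folklore] -/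
theorem fold_of_le {y : Fin (d + 1) → ℤ} (h : (n : ℤ) * (M μ : ℤ) ≤ y μ) : fold n M μ y = refl n M μ y := by
  rw [fold, if_neg (not_lt.2 h)]

/-- the fold fixes the box. [folklore] -/
theorem fold_of_mem {y : Fin (d + 1) → ℤ} (hy : y ∈ boxDom (fun i => n * M i)) : fold n M μ y = y :=
  fold_of_lt (lt_of_mem hy)

/-- the fold of a mirror image is the original. [folklore] -/
theorem fold_refl_of_mem {y : Fin (d + 1) → ℤ} (hy : y ∈ boxDom (fun i => n * M i)) :
    fold n M μ (refl n M μ y) = y := by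
  rw [fold_of_le (le_refl_of_mem hy), refl_refl]

/-- the fold maps the doubled box onto the box. [folklore] -/
theorem fold_mem {y : Fin (d + 1) → ℤ} (hy : y ∈ boxDom (fun i => n * dbl M μ i)) :
    fold n M μ y ∈ boxDom (fun i => n * M i) := by
  have h := mem_dbl_iff.1 hy
  rw [mem_box_iff]
  by_cases hlt : y μ < (n : ℤ) * (M μ : ℤ)
  · rw [fold_of_lt hlt]
    intro i
    by_cases hi : i = μ
    · subst hi; exact ⟨h.2.1, hlt⟩
    · exact h.1 i hi
  · rw [fold_of_le (not_lt.1 hlt)]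
    intro i
    by_cases hi : i = μ
    · subst hi
      rw [refl_apply_same]
      constructor <;> linarith [h.2.2, not_lt.1 hlt]
    · rw [refl_apply_ne _ hi]; exact h.1 i hi

/-- the fold is invariant under the reflection. [folklore] -/
theorem fold_refl {y : Fin (d + 1) → ℤ} (hy : y ∈ boxDom (fun i => n * dbl M μ i)) :
    fold n M μ (refl n M μ y) = fold n M μ y := by
  by_cases hlt : y μ < (n : ℤ) * (M μ : ℤ)
  · have hle : (n : ℤ) * (M μ : ℤ) ≤ refl n M μ y μ := by
      rw [refl_apply_same]; linarith
    rw [fold_of_le hle, refl_refl, fold_of_lt hlt]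
  · have h := (mem_dbl_iff.1 hy).2.2
    have hlt' : refl n M μ y μ < (n : ℤ) * (M μ : ℤ) := by
      rw [refl_apply_same]; linarith [not_lt.1 hlt]
    rw [fold_of_lt hlt', fold_of_le (not_lt.1 hlt)]

/-- a second-half point folds to the first half: characterisation of the fibres of the fold. [folklore] -/
theorem fold_eq_iff {y w : Fin (d + 1) → ℤ} (hy : y ∈ boxDom (fun i => n * dbl M μ i))
    (hw : w ∈ boxDom (fun i => n * M i)) : fold n M μ y = w ↔ y = w ∨ y = refl n M μ w := by
  constructor
  · intro h
    by_cases hlt : y μ < (n : ℤ) * (M μ : ℤ)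
    · left; rwa [fold_of_lt hlt] at h
    · right
      rw [fold_of_le (not_lt.1 hlt)] at h
      rw [← h, refl_refl]
  · rintro (rfl | rfl)
    · exact fold_of_mem hw
    · exact fold_refl_of_mem hw

/-- a mirror image of a box point is never a box point. [folklore] -/
theorem refl_ne_of_mem {y w : Fin (d + 1) → ℤ} (hy : y ∈ boxDom (fun i => n * M i))
    (hw : w ∈ boxDom (fun i => n * M i)) : refl n M μ w ≠ y := by
  intro h
  have h1 := le_refl_of_mem (n := n) (M := M) (μ := μ) hw
  rw [h] at h1
  exact absurd (lt_of_mem hy) (not_lt.2 h1)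

/-! ### blocks, neighbours and the Neumann degree under the reflection -/

/-- block labels reflect: `blk n (refl y) = (2M_μ − 1 − blk_μ y, blk_i y)` — the mirror lies between blocks
(`n ∣ nM_μ`), so blocks go to blocks. [folklore] -/
theorem blk_refl (hn : 1 ≤ n) (y : Fin (d + 1) → ℤ) :
    blk n (refl n M μ y) = Function.update (blk n y) μ (2 * (M μ : ℤ) - 1 - blk n y μ) := by
  have hn0 : (0 : ℤ) < n := by exact_mod_cast hn
  funext i
  by_cases hi : i = μ
  · subst hi
    simp only [blk, Function.update_self, refl_apply_same]
    have e : 2 * ((n : ℤ) * (M i : ℤ)) - 1 - y i = (-1 - y i) + (2 * (M i : ℤ)) * n := by ring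
    rw [e, Int.add_mul_ediv_right _ _ hn0.ne', neg_one_sub_ediv hn0]
    ring
  · simp only [blk, Function.update_of_ne hi, refl_apply_ne _ hi]

/-- same block after reflecting both points iff same block before. [folklore] -/
theorem blk_refl_eq_iff (hn : 1 ≤ n) (y t : Fin (d + 1) → ℤ) :
    blk n (refl n M μ y) = blk n (refl n M μ t) ↔ blk n y = blk n t := by
  rw [blk_refl hn, blk_refl hn]
  constructor
  · intro h
    funext i
    have hi := congrFun h i
    by_cases hμ : i = μ
    · subst hμ
      simp only [Function.update_self] at hi
      linarith
    · simpa [Function.update_of_ne hμ] using hi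
  · intro h
    rw [h]

/-- a box point and a mirror image of a box point lie in different blocks. [folklore] -/
theorem blk_refl_ne_of_mem (hn : 1 ≤ n) {t w : Fin (d + 1) → ℤ} (ht : t ∈ boxDom (fun i => n * M i))
    (hw : w ∈ boxDom (fun i => n * M i)) : blk n (refl n M μ w) ≠ blk n t := by
  have hn0 : (0 : ℤ) < n := by exact_mod_cast hn
  intro h
  have hμ := congrFun h μ
  rw [blk_refl hn, Function.update_self] at hμ
  simp only [blk] at hμ
  have h1 : w μ / (n : ℤ) < M μ := Int.ediv_lt_of_lt_mul hn0 (by linarith [lt_of_mem (μ := μ) hw])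
  have h2 : t μ / (n : ℤ) < M μ := Int.ediv_lt_of_lt_mul hn0 (by linarith [lt_of_mem (μ := μ) ht])
  linarith

/-- the reflection acts on difference vectors by the sign flip of the `μ`-coordinate. [folklore] -/
theorem refl_sub_refl (z t : Fin (d + 1) → ℤ) :
    refl n M μ z - refl n M μ t = sflip (fun i => decide (i = μ)) (z - t) := by
  funext i
  by_cases hi : i = μ
  · subst hi
    simp [sflip, refl_apply_same]
  · simp [sflip, hi]

/-- the reflection preserves the nearest-neighbour relation. [folklore] -/
theorem refl_mem_nbrs_refl_iff (z t : Fin (d + 1) → ℤ) : refl n M μ z ∈ nbrs (refl n M μ t) ↔ z ∈ nbrs t := by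
  rw [mem_nbrs_iff_sub, mem_nbrs_iff_sub, refl_sub_refl, unitVec_sflip_iff]

/-- the Neumann degree (number of neighbours inside the doubled box) is reflection invariant. [folklore] -/
theorem card_nbrs_refl (t : Fin (d + 1) → ℤ) :
    ((nbrs (refl n M μ t)).filter fun z => z ∈ boxDom (fun i => n * dbl M μ i)).card
      = ((nbrs t).filter fun z => z ∈ boxDom (fun i => n * dbl M μ i)).card := by
  symm
  apply Finset.card_bij (fun z _ => refl n M μ z)
  · intro z hz
    rw [Finset.mem_filter] at hz ⊢
    exact ⟨(refl_mem_nbrs_refl_iff z t).2 hz.1, refl_mem_dbl hz.2⟩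
  · intro z₁ _ z₂ _ h
    exact refl_injective h
  · intro w hw
    rw [Finset.mem_filter] at hw
    refine ⟨refl n M μ w, ?_, refl_refl w⟩
    rw [Finset.mem_filter]
    refine ⟨?_, refl_mem_dbl hw.2⟩
    have h := (refl_mem_nbrs_refl_iff (n := n) (M := M) (μ := μ) (refl n M μ w) t)
    rw [refl_refl] at h
    exact h.1 hw.1

/-- **REFLECTION SYMMETRY OF THE NEUMANN LAPLACIAN OF THE DOUBLED BOX.** [folklore] -/
theorem neumannLapK_refl (t y : Fin (d + 1) → ℤ) :
    (neumannLapK (fun i => n * dbl M μ i) (refl n M μ t) (refl n M μ y) : ℝ)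
      = neumannLapK (fun i => n * dbl M μ i) t y := by
  unfold neumannLapK
  by_cases h : y = t
  · subst h
    rw [if_pos rfl, if_pos rfl, card_nbrs_refl]
  · have h' : refl n M μ y ≠ refl n M μ t := fun e => h (refl_injective e)
    rw [if_neg h', if_neg h]
    by_cases hn' : y ∈ nbrs t
    · rw [if_pos hn', if_pos ((refl_mem_nbrs_refl_iff y t).2 hn')]
    · rw [if_neg hn', if_neg (mt (refl_mem_nbrs_refl_iff y t).1 hn')]

/-- the mirror image of a box point `w` is a neighbour of a box point `t` iff `w = t` lies on the last `μ`-layer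
(the bond `⟨t, t + e_μ⟩` crosses the mirror and `refl t = t + e_μ`). [folklore] -/
theorem refl_mem_nbrs_iff {t w : Fin (d + 1) → ℤ} (ht : t ∈ boxDom (fun i => n * M i))
    (hw : w ∈ boxDom (fun i => n * M i)) :
    refl n M μ w ∈ nbrs t ↔ w = t ∧ t μ = (n : ℤ) * (M μ : ℤ) - 1 := by
  have htμ := lt_of_mem (μ := μ) ht
  have hwμ := lt_of_mem (μ := μ) hw
  constructor
  · intro h
    obtain ⟨i, hi⟩ := mem_nbrs_iff_sub.1 h
    have hμ : (refl n M μ w - t) μ = 2 * ((n : ℤ) * (M μ : ℤ)) - 1 - w μ - t μ := by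
      rw [Pi.sub_apply, refl_apply_same]
    have hge : 1 ≤ (refl n M μ w - t) μ := by rw [hμ]; linarith
    have hiμ : i = μ := by
      by_contra hne
      rcases hi with e | e
      · have := congrFun e μ
        rw [this, Pi.single_apply, if_neg (Ne.symm hne)] at hge
        exact absurd hge (by norm_num)
      · have := congrFun e μ
        rw [this, Pi.neg_apply, Pi.single_apply, if_neg (Ne.symm hne)] at hge
        exact absurd hge (by norm_num)
    subst hiμ
    rcases hi with e | e
    · have hcoord := congrFun e i
      rw [hμ, Pi.single_eq_same] at hcoord
      have hwt : w i = t i := by linarith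
      refine ⟨?_, by linarith⟩
      funext j
      by_cases hj : j = i
      · subst hj; exact hwt
      · have := congrFun e j
        rw [Pi.sub_apply, refl_apply_ne _ hj, Pi.single_apply, if_neg hj] at this
        linarith
    · have hcoord := congrFun e i
      rw [hμ, Pi.neg_apply, Pi.single_eq_same] at hcoord
      linarith
  · rintro ⟨rfl, hlast⟩
    rw [mem_nbrs_iff_sub]
    refine ⟨μ, Or.inl ?_⟩
    funext j
    by_cases hj : j = μ
    · subst hj
      rw [Pi.sub_apply, refl_apply_same, Pi.single_eq_same, hlast]; ring
    · rw [Pi.sub_apply, refl_apply_ne _ hj, Pi.single_apply, if_neg hj, sub_self]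

/-- the neighbours of a box point inside the DOUBLED box that are not in the box: exactly `t + e_μ` when `t` lies on
the last `μ`-layer, none otherwise. [folklore] -/
theorem mem_nbrs_dbl_not_box_iff {t z : Fin (d + 1) → ℤ} (ht : t ∈ boxDom (fun i => n * M i))
    (hz : z ∈ nbrs t) :
    (z ∈ boxDom (fun i => n * dbl M μ i) ∧ z ∉ boxDom (fun i => n * M i)) ↔
      (t μ = (n : ℤ) * (M μ : ℤ) - 1 ∧ z = t + Pi.single μ 1) := by
  have htb := mem_box_iff.1 ht
  constructor
  · rintro ⟨hz2, hzb⟩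
    have h2 := mem_dbl_iff.1 hz2
    rw [mem_box_iff] at hzb
    push Not at hzb
    obtain ⟨j, hj⟩ := hzb
    have hjμ : j = μ := by
      by_contra hne
      exact absurd (hj (h2.1 j hne).1) (not_le.2 (h2.1 j hne).2)
    subst hjμ
    have hzμ : (n : ℤ) * (M j : ℤ) ≤ z j := hj h2.2.1
    obtain ⟨i, e | e⟩ := mem_nbrs.1 hz
    · by_cases hij : i = j
      · subst hij
        have := congrFun e i
        rw [Pi.add_apply, Pi.single_eq_same] at this
        refine ⟨by linarith [(htb i).2], e⟩
      · have := congrFun e j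
        rw [Pi.add_apply, Pi.single_apply, if_neg (Ne.symm hij) ] at this
        linarith [(htb j).2]
    · have := congrFun e j
      by_cases hij : i = j
      · subst hij
        rw [Pi.sub_apply, Pi.single_eq_same] at this
        linarith [(htb i).2]
      · rw [Pi.sub_apply, Pi.single_apply, if_neg (Ne.symm hij)] at this
        linarith [(htb j).2]
  · rintro ⟨hlast, rfl⟩
    constructor
    · rw [mem_dbl_iff]
      refine ⟨fun i hi => ?_, ?_⟩
      · rw [Pi.add_apply, Pi.single_apply, if_neg hi, add_zero]; exact htb i
      · rw [Pi.add_apply, Pi.single_eq_same, hlast]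
        constructor <;> nlinarith [(htb μ).1, (htb μ).2]
    · rw [mem_box_iff]
      push Not
      refine ⟨μ, fun _ => ?_⟩
      rw [Pi.add_apply, Pi.single_eq_same, hlast]; linarith

/-- **THE NEUMANN DEGREE OF A BOX POINT IN THE DOUBLED BOX** is its degree in the box, plus one on the last
`μ`-layer (the bond through the mirror). [folklore] -/
theorem card_nbrs_dbl {t : Fin (d + 1) → ℤ} (ht : t ∈ boxDom (fun i => n * M i)) :
    (((nbrs t).filter fun z => z ∈ boxDom (fun i => n * dbl M μ i)).card : ℝ)
      = ((nbrs t).filter fun z => z ∈ boxDom (fun i => n * M i)).card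
        + if t μ = (n : ℤ) * (M μ : ℤ) - 1 then 1 else 0 := by
  set s := (nbrs t).filter fun z => z ∈ boxDom (fun i => n * dbl M μ i) with hs
  have hsplit := Finset.card_filter_add_card_filter_not (s := s)
    (fun z => z ∈ boxDom (fun i => n * M i))
  have h1 : s.filter (fun z => z ∈ boxDom (fun i => n * M i))
      = (nbrs t).filter fun z => z ∈ boxDom (fun i => n * M i) := by
    rw [hs, Finset.filter_filter]
    apply Finset.filter_congr
    intro z _
    exact ⟨fun h => h.2, fun h => ⟨mem_dbl_of_mem h, h⟩⟩
  have h2 : (s.filter fun z => z ∉ boxDom (fun i => n * M i))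
      = if t μ = (n : ℤ) * (M μ : ℤ) - 1 then {t + Pi.single μ 1} else ∅ := by
    ext z
    rw [hs, Finset.filter_filter, Finset.mem_filter]
    constructor
    · rintro ⟨hz, hz2⟩
      obtain ⟨hlast, rfl⟩ := (mem_nbrs_dbl_not_box_iff ht hz).1 hz2
      rw [if_pos hlast]
      exact Finset.mem_singleton_self _
    · intro h
      split_ifs at h with hlast
      · rw [Finset.mem_singleton] at h
        subst h
        have hz : t + Pi.single μ 1 ∈ nbrs t := mem_nbrs.2 ⟨μ, Or.inl rfl⟩
        exact ⟨hz, (mem_nbrs_dbl_not_box_iff ht hz).2 ⟨hlast, rfl⟩⟩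
      · exact absurd h (Finset.notMem_empty _)
  rw [h1, h2] at hsplit
  rw [← hsplit]
  push_cast
  split_ifs <;> simp

end Geometry

/-! ## §2 The operator (1.6) at `A = 0` commutes with the fold; `G_k(□₂,0)(f ∘ fold) = (G_k(□,0)f) ∘ fold` -/

section Operator

variable {n : ℕ} {M : Fin (d + 1) → ℕ} {μ : Fin (d + 1)}

/-- the kernel `c₁(−Δ^N_X) + msq·δ + a′·1_{same b-block}` of `B4BoxCov237.opBoxR` as a function of lattice points.
[folklore] -/
def ker (c₁ msq a' : ℝ) (b : ℕ) (N : Fin (d + 1) → ℕ) (x y : Fin (d + 1) → ℤ) : ℝ :=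
  c₁ * neumannLapK N x y + (diagK msq x y + avgK a' b x y)

/-- the entries of the lineage's box operator `boxOpR n a m² M` (B4 (2.44) in lattice units: `n²(−Δ^N) + m² +
(a/n^{d+1})·1_{same n-block}` on `Π[0, nM)`) are the kernel `ker`. [folklore] -/
theorem boxOpR_apply (a m2 : ℝ) (M : Fin (d + 1) → ℕ) (x y : ↥(boxDom (fun i => n * M i))) :
    boxOpR n a m2 M x y = ker ((n : ℝ) ^ 2) m2 (a * ((n : ℝ) ^ (d + 1))⁻¹) n (fun i => n * M i) x.1 y.1 := rfl

/-- **REFLECTION SYMMETRY OF THE OPERATOR OF THE DOUBLED BOX**: the Neumann Laplacian, the mass and the block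
averaging of `□₂` are invariant under the reflection in the mirror (blocks go to blocks since the mirror lies between
blocks). [cite: Balaban1983RegularityDecay, p. 584 (2.42)–(2.44), dictionary] -/
theorem ker_refl (hn : 1 ≤ n) (c₁ msq a' : ℝ) (t y : Fin (d + 1) → ℤ) :
    ker c₁ msq a' n (fun i => n * dbl M μ i) (refl n M μ t) (refl n M μ y)
      = ker c₁ msq a' n (fun i => n * dbl M μ i) t y := by
  unfold ker
  rw [neumannLapK_refl]
  congr 2
  · unfold diagK
    by_cases h : y = t
    · rw [if_pos h, if_pos (congrArg _ h)]
    · rw [if_neg h, if_neg (fun e => h (refl_injective e))]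
  · unfold avgK
    by_cases h : blk n y = blk n t
    · rw [if_pos h, if_pos ((blk_refl_eq_iff hn y t).2 h)]
    · rw [if_neg h, if_neg (fun e => h ((blk_refl_eq_iff hn y t).1 e))]

/-- **THE FOLDED KERNEL OF THE DOUBLED BOX IS THE KERNEL OF THE BOX** (first half): for box points `t, w`,
`K_{□₂}(t, w) + K_{□₂}(t, refl w) = K_□(t, w)` — off the diagonal the two kernels agree and the mirror term vanishes;
on the diagonal the extra Neumann degree of a last-layer point in `□₂` (the bond through the mirror) is cancelled by
the mirror term `K_{□₂}(t, refl t) = −c₁` (that bond, folded back: `fold(t + e_μ) = t`).  This is the lattice form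
of «the method of images» for Neumann conditions. [cite: Balaban1983RegularityDecay, p. 584 (2.42), dictionary] -/
theorem ker_fold (hn : 1 ≤ n) (c₁ msq a' : ℝ) {t w : Fin (d + 1) → ℤ} (ht : t ∈ boxDom (fun i => n * M i))
    (hw : w ∈ boxDom (fun i => n * M i)) :
    ker c₁ msq a' n (fun i => n * dbl M μ i) t w + ker c₁ msq a' n (fun i => n * dbl M μ i) t (refl n M μ w)
      = ker c₁ msq a' n (fun i => n * M i) t w := by
  have hne : refl n M μ w ≠ t := refl_ne_of_mem ht hw
  have hdiag : (diagK msq t (refl n M μ w) : ℝ) = 0 := by rw [diagK, if_neg hne]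
  have havg : (avgK a' n t (refl n M μ w) : ℝ) = 0 := by rw [avgK, if_neg (blk_refl_ne_of_mem hn ht hw)]
  unfold ker
  rw [hdiag, havg]
  by_cases hwt : w = t
  · subst hwt
    have hL2 : (neumannLapK (fun i => n * dbl M μ i) w w : ℝ) = neumannLapK (fun i => n * M i) w w
        + if w μ = (n : ℤ) * (M μ : ℤ) - 1 then 1 else 0 := by
      unfold neumannLapK; rw [if_pos rfl, if_pos rfl, card_nbrs_dbl hw]
    have hL2' : (neumannLapK (fun i => n * dbl M μ i) w (refl n M μ w) : ℝ)
        = if w μ = (n : ℤ) * (M μ : ℤ) - 1 then -1 else 0 := by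
      unfold neumannLapK
      rw [if_neg hne]
      by_cases hlast : w μ = (n : ℤ) * (M μ : ℤ) - 1
      · rw [if_pos ((refl_mem_nbrs_iff hw hw).2 ⟨rfl, hlast⟩), if_pos hlast]
      · rw [if_neg (fun h => hlast ((refl_mem_nbrs_iff hw hw).1 h).2), if_neg hlast]
    rw [hL2, hL2']
    split_ifs <;> ring
  · have hL2 : (neumannLapK (fun i => n * dbl M μ i) t w : ℝ) = neumannLapK (fun i => n * M i) t w := by
      unfold neumannLapK; rw [if_neg hwt, if_neg hwt]
    have hL2' : (neumannLapK (fun i => n * dbl M μ i) t (refl n M μ w) : ℝ) = 0 := by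
      unfold neumannLapK
      rw [if_neg hne, if_neg (fun h => hwt ((refl_mem_nbrs_iff ht hw).1 h).1)]
    rw [hL2, hL2']
    ring

/-- a first-half point of the doubled box is a box point. [folklore] -/
theorem mem_of_dbl_of_lt {y : Fin (d + 1) → ℤ} (hy : y ∈ boxDom (fun i => n * dbl M μ i))
    (h : y μ < (n : ℤ) * (M μ : ℤ)) : y ∈ boxDom (fun i => n * M i) := by
  have := fold_mem hy
  rwa [fold_of_lt h] at this

/-- the mirror image of a second-half point of the doubled box is a box point. [folklore] -/
theorem refl_mem_of_dbl_of_le {y : Fin (d + 1) → ℤ} (hy : y ∈ boxDom (fun i => n * dbl M μ i))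
    (h : (n : ℤ) * (M μ : ℤ) ≤ y μ) : refl n M μ y ∈ boxDom (fun i => n * M i) := by
  have := fold_mem hy
  rwa [fold_of_le h] at this

variable (n M μ)

/-- **THE DOUBLED BOX IS THE DISJOINT UNION OF THE BOX AND ITS MIRROR IMAGE** (as an equivalence of fine-point
types). [folklore] -/
def splitEquiv :
    ↥(boxDom (fun i => n * M i)) ⊕ ↥(boxDom (fun i => n * M i)) ≃ ↥(boxDom (fun i => n * dbl M μ i)) where
  toFun s := match s with
    | Sum.inl w => ⟨w.1, mem_dbl_of_mem w.2⟩
    | Sum.inr w => ⟨refl n M μ w.1, refl_mem_dbl_of_mem w.2⟩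
  invFun y :=
    if h : y.1 μ < (n : ℤ) * (M μ : ℤ) then Sum.inl ⟨y.1, mem_of_dbl_of_lt y.2 h⟩
    else Sum.inr ⟨refl n M μ y.1, refl_mem_of_dbl_of_le y.2 (not_lt.1 h)⟩
  left_inv s := by
    cases s with
    | inl w =>
      simp only
      rw [dif_pos (lt_of_mem w.2)]
    | inr w =>
      simp only
      rw [dif_neg (not_lt.2 (le_refl_of_mem w.2))]
      simp only [refl_refl]
  right_inv y := by
    by_cases h : y.1 μ < (n : ℤ) * (M μ : ℤ)
    · simp only [dif_pos h]
    · simp only [dif_neg h, refl_refl]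

/-- the reflection as a bijection of the fine points of the doubled box. [folklore] -/
def reflEquiv : ↥(boxDom (fun i => n * dbl M μ i)) ≃ ↥(boxDom (fun i => n * dbl M μ i)) where
  toFun y := ⟨refl n M μ y.1, refl_mem_dbl y.2⟩
  invFun y := ⟨refl n M μ y.1, refl_mem_dbl y.2⟩
  left_inv y := Subtype.ext (refl_refl y.1)
  right_inv y := Subtype.ext (refl_refl y.1)

/-- the fold as a map of fine points `□₂ → □`. [cite: Balaban1983RegularityDecay, p. 584 (2.42), dictionary] -/
def foldPt (y : ↥(boxDom (fun i => n * dbl M μ i))) : ↥(boxDom (fun i => n * M i)) :=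
  ⟨fold n M μ y.1, fold_mem y.2⟩

variable {n M μ}

/-- the coordinates of the reflected point. [folklore] -/
@[simp] theorem reflEquiv_val (y : ↥(boxDom (fun i => n * dbl M μ i))) :
    (reflEquiv n M μ y).1 = refl n M μ y.1 := rfl

/-- the coordinates of the folded point. [folklore] -/
@[simp] theorem foldPt_val (y : ↥(boxDom (fun i => n * dbl M μ i))) : (foldPt n M μ y).1 = fold n M μ y.1 := rfl

/-- the fold is reflection invariant. [folklore] -/
theorem foldPt_reflEquiv (y : ↥(boxDom (fun i => n * dbl M μ i))) :
    foldPt n M μ (reflEquiv n M μ y) = foldPt n M μ y :=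
  Subtype.ext (fold_refl y.2)

/-- a sum over the doubled box = the sum over the box + the sum over its mirror image. [folklore] -/
theorem sum_dbl (g : ↥(boxDom (fun i => n * dbl M μ i)) → ℝ) :
    ∑ y, g y = ∑ w : ↥(boxDom (fun i => n * M i)), g ⟨w.1, mem_dbl_of_mem w.2⟩
      + ∑ w : ↥(boxDom (fun i => n * M i)), g ⟨refl n M μ w.1, refl_mem_dbl_of_mem w.2⟩ := by
  rw [← Equiv.sum_comp (splitEquiv n M μ) g, Fintype.sum_sum_type]
  rfl

/-- (R1), first half: `(A_{□₂}(u ∘ fold))(t) = (A_□ u)(t)` for a box point `t`. [folklore] -/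
theorem mulVec_fold_first (hn : 1 ≤ n) (a m2 : ℝ) (u : ↥(boxDom (fun i => n * M i)) → ℝ)
    (t : ↥(boxDom (fun i => n * M i))) :
    (boxOpR n a m2 (dbl M μ) *ᵥ (u ∘ foldPt n M μ)) ⟨t.1, mem_dbl_of_mem t.2⟩ = (boxOpR n a m2 M *ᵥ u) t := by
  simp only [Matrix.mulVec, dotProduct, Function.comp_apply]
  rw [sum_dbl, ← Finset.sum_add_distrib]
  refine Finset.sum_congr rfl fun w _ => ?_
  have e1 : foldPt n M μ ⟨w.1, mem_dbl_of_mem w.2⟩ = w := Subtype.ext (fold_of_mem w.2)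
  have e2 : foldPt n M μ ⟨refl n M μ w.1, refl_mem_dbl_of_mem w.2⟩ = w := Subtype.ext (fold_refl_of_mem w.2)
  rw [e1, e2, ← add_mul, boxOpR_apply, boxOpR_apply, boxOpR_apply]
  exact congrArg (· * u w) (ker_fold hn _ _ _ t.2 w.2)

/-- **(R1) THE OPERATOR (1.6) AT `A = 0` COMMUTES WITH THE FOLD**: `A_{□₂}(u ∘ fold) = (A_□ u) ∘ fold` on the whole
doubled box (first half: the folded kernel identity; mirror half: by the reflection symmetry of `A_{□₂}`).
[cite: Balaban1983RegularityDecay, p. 584 (2.42) with (2.44), lattice form, dictionary] -/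
theorem boxOpR_mulVec_fold (hn : 1 ≤ n) (a m2 : ℝ) (u : ↥(boxDom (fun i => n * M i)) → ℝ)
    (t : ↥(boxDom (fun i => n * dbl M μ i))) :
    (boxOpR n a m2 (dbl M μ) *ᵥ (u ∘ foldPt n M μ)) t = (boxOpR n a m2 M *ᵥ u) (foldPt n M μ t) := by
  by_cases hlt : t.1 μ < (n : ℤ) * (M μ : ℤ)
  · have ht : t.1 ∈ boxDom (fun i => n * M i) := mem_of_dbl_of_lt t.2 hlt
    have ef : foldPt n M μ t = ⟨t.1, ht⟩ := Subtype.ext (fold_of_lt hlt)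
    rw [ef, ← mulVec_fold_first hn a m2 u ⟨t.1, ht⟩]
  · have hle := not_lt.1 hlt
    have ht' : refl n M μ t.1 ∈ boxDom (fun i => n * M i) := refl_mem_of_dbl_of_le t.2 hle
    have ef : foldPt n M μ t = ⟨refl n M μ t.1, ht'⟩ := Subtype.ext (fold_of_le hle)
    rw [ef, ← mulVec_fold_first hn a m2 u ⟨refl n M μ t.1, ht'⟩]
    simp only [Matrix.mulVec, dotProduct, Function.comp_apply]
    conv_rhs => rw [← Equiv.sum_comp (reflEquiv n M μ)]
    refine Finset.sum_congr rfl fun y _ => ?_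
    rw [foldPt_reflEquiv, boxOpR_apply, boxOpR_apply, reflEquiv_val, ker_refl hn]

/-- **(R2) THE GREEN'S FUNCTION OF THE DOUBLED BOX ON FOLD-INVARIANT SOURCES IS THE GREEN'S FUNCTION OF THE BOX**:
`G_k(□₂, 0)(f ∘ fold) = (G_k(□, 0)f) ∘ fold` — the one-reflection case of the image representation (2.42) of `G_k(□)`
(`a > 0`, `m² ≥ 0`, so both operators are invertible, `B4Lower18.fineOpR_isUnit`).
[cite: Balaban1983RegularityDecay, p. 584 (2.42) «We represent G_j(□) … using the multiple reflection method», one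
reflection, lattice form] -/
theorem green_fold (hn : 1 ≤ n) {a m2 : ℝ} (ha : 0 < a) (hm : 0 ≤ m2)
    (f : ↥(boxDom (fun i => n * M i)) → ℝ) (t : ↥(boxDom (fun i => n * dbl M μ i))) :
    ((boxOpR n a m2 (dbl M μ))⁻¹ *ᵥ (f ∘ foldPt n M μ)) t = ((boxOpR n a m2 M)⁻¹ *ᵥ f) (foldPt n M μ t) := by
  have hpos : 0 < min 2 a + m2 := add_pos_of_pos_of_nonneg (lt_min two_pos ha) hm
  have hU : IsUnit (boxOpR n a m2 M).det := by
    rw [← fineOpR_boxDom]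
    exact (Matrix.isUnit_iff_isUnit_det _).1 (fineOpR_isUnit hn ha.le hpos (boxDom_isBlockUnion hn M))
  have hU2 : IsUnit (boxOpR n a m2 (dbl M μ)).det := by
    rw [← fineOpR_boxDom]
    exact (Matrix.isUnit_iff_isUnit_det _).1 (fineOpR_isUnit hn ha.le hpos (boxDom_isBlockUnion hn (dbl M μ)))
  set u := (boxOpR n a m2 M)⁻¹ *ᵥ f with hu
  have h1 : boxOpR n a m2 M *ᵥ u = f := by
    rw [hu, Matrix.mulVec_mulVec, Matrix.mul_nonsing_inv _ hU, Matrix.one_mulVec]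
  have h2 : boxOpR n a m2 (dbl M μ) *ᵥ (u ∘ foldPt n M μ) = f ∘ foldPt n M μ := by
    funext s
    rw [boxOpR_mulVec_fold hn, h1, Function.comp_apply]
  rw [← h2, Matrix.mulVec_mulVec, Matrix.nonsing_inv_mul _ hU2, Matrix.one_mulVec, Function.comp_apply]

/-- (R2) pointwise, for any source `v` that is the folded `f`. [folklore] -/
theorem green_fold_apply (hn : 1 ≤ n) {a m2 : ℝ} (ha : 0 < a) (hm : 0 ≤ m2)
    (f : ↥(boxDom (fun i => n * M i)) → ℝ) (v : ↥(boxDom (fun i => n * dbl M μ i)) → ℝ)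
    (hv : ∀ z, v z = f (foldPt n M μ z)) (t : ↥(boxDom (fun i => n * dbl M μ i))) :
    ((boxOpR n a m2 (dbl M μ))⁻¹ *ᵥ v) t = ((boxOpR n a m2 M)⁻¹ *ᵥ f) (foldPt n M μ t) := by
  have e : v = f ∘ foldPt n M μ := funext hv
  rw [e]
  exact green_fold hn ha hm f t

end Operator

/-! ## §3 Distances under the fold; the Hölder bound for `D_μG_k(□,0)f` UP TO THE FACE -/

section Face

variable {n : ℕ} {M : Fin (d + 1) → ℕ} {μ : Fin (d + 1)}

/-- the fold fixes the coordinates `≠ μ`. [folklore] -/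
theorem fold_apply_ne (y : Fin (d + 1) → ℤ) {j : Fin (d + 1)} (hj : j ≠ μ) : fold n M μ y j = y j := by
  unfold fold
  split_ifs
  · rfl
  · exact refl_apply_ne _ hj

/-- the sup-norm of a vector supported on one coordinate. [folklore] -/
theorem supNorm_eq_of_single {v : Fin (d + 1) → ℤ} {μ : Fin (d + 1)} (h : ∀ j, j ≠ μ → v j = 0) :
    supNorm v = ((|v μ| : ℤ) : ℝ) :=
  le_antisymm (supNorm_le_of_forall fun j => by
    by_cases hj : j = μ
    · subst hj; exact le_rfl
    · rw [h j hj, abs_zero, Int.cast_zero]; positivity) (abs_le_supNorm v μ)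

/-- **FOLDING DOES NOT INCREASE THE DISTANCE TO A BOX POINT**: `|x − fold z|_∞ ≤ |x − z|_∞` for `x ∈ □`,
`z ∈ □₂`. [folklore] -/
theorem supNorm_sub_fold_le {x z : Fin (d + 1) → ℤ} (hx : x ∈ boxDom (fun i => n * M i))
    (hz : z ∈ boxDom (fun i => n * dbl M μ i)) : supNorm (x - fold n M μ z) ≤ supNorm (x - z) := by
  apply supNorm_le_of_forall
  intro j
  refine le_trans ?_ (abs_le_supNorm (x - z) j)
  have key : |(x - fold n M μ z) j| ≤ |(x - z) j| := by
    rw [Pi.sub_apply, Pi.sub_apply]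
    by_cases hj : j = μ
    · subst hj
      by_cases hlt : z j < (n : ℤ) * (M j : ℤ)
      · rw [fold_of_lt hlt]
      · rw [fold_of_le (not_lt.1 hlt), refl_apply_same]
        have hxj := (mem_box_iff.1 hx) j
        have hzj := (mem_dbl_iff.1 hz).2
        rw [abs_of_nonpos (by linarith [not_lt.1 hlt] : x j - z j ≤ 0), abs_le]
        constructor <;> linarith [not_lt.1 hlt]
    · rw [fold_apply_ne _ hj]
  exact_mod_cast key

/-- **… AND THE MIRROR BOND IS NOT CLOSER THAN ONE STEP LESS**: `|x − fold z|_∞ ≤ |refl(x + e_μ) − z|_∞ + 1` for a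
bond `⟨x, x + e_μ⟩` of `□` and `z ∈ □₂`. [folklore] -/
theorem supNorm_sub_fold_le_refl {x z : Fin (d + 1) → ℤ} (hx : x ∈ boxDom (fun i => n * M i))
    (hxe : x + Pi.single μ 1 ∈ boxDom (fun i => n * M i)) (hz : z ∈ boxDom (fun i => n * dbl M μ i)) :
    supNorm (x - fold n M μ z) ≤ supNorm (refl n M μ (x + Pi.single μ 1) - z) + 1 := by
  apply supNorm_le_of_forall
  intro j
  have hq := abs_le_supNorm (refl n M μ (x + Pi.single μ 1) - z) j
  have key : |(x - fold n M μ z) j| ≤ |(refl n M μ (x + Pi.single μ 1) - z) j| + 1 := by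
    rw [Pi.sub_apply, Pi.sub_apply]
    by_cases hj : j = μ
    · subst hj
      rw [refl_apply_same, Pi.add_apply, Pi.single_eq_same]
      have hxj := (mem_box_iff.1 hx) j
      have hxej := (mem_box_iff.1 hxe) j
      rw [Pi.add_apply, Pi.single_eq_same] at hxej
      have hzj := (mem_dbl_iff.1 hz).2
      by_cases hlt : z j < (n : ℤ) * (M j : ℤ)
      · rw [fold_of_lt hlt,
          abs_of_nonneg (by linarith : (0 : ℤ) ≤ 2 * ((n : ℤ) * (M j : ℤ)) - 1 - (x j + 1) - z j), abs_le]
        constructor <;> linarith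
      · rw [fold_of_le (not_lt.1 hlt), refl_apply_same]
        have e : x j - (2 * ((n : ℤ) * (M j : ℤ)) - 1 - z j)
            = -(2 * ((n : ℤ) * (M j : ℤ)) - 1 - (x j + 1) - z j) - 1 := by ring
        rw [e, abs_le]
        constructor <;> linarith [le_abs_self (2 * ((n : ℤ) * (M j : ℤ)) - 1 - (x j + 1) - z j),
          neg_abs_le (2 * ((n : ℤ) * (M j : ℤ)) - 1 - (x j + 1) - z j)]
    · rw [fold_apply_ne _ hj, refl_apply_ne _ hj, Pi.add_apply, Pi.single_apply, if_neg hj, add_zero]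
      linarith [abs_nonneg (x j - z j)]
  calc ((|(x - fold n M μ z) j| : ℤ) : ℝ) ≤ ((|(refl n M μ (x + Pi.single μ 1) - z) j| : ℤ) : ℝ) + 1 := by
        exact_mod_cast key
    _ ≤ supNorm (refl n M μ (x + Pi.single μ 1) - z) + 1 := by linarith

/-- the distance between a bond start `x` and the start `refl(x + e_μ)` of its mirror bond is twice the distance
`nM_μ − 1 − x_μ` of `x` to the last `μ`-layer. [folklore] -/
theorem supNorm_refl_sub {x : Fin (d + 1) → ℤ} (hxe : x + Pi.single μ 1 ∈ boxDom (fun i => n * M i)) :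
    supNorm (refl n M μ (x + Pi.single μ 1) - x)
      = 2 * (((n : ℤ) * (M μ : ℤ) : ℤ) : ℝ) - 2 - 2 * ((x μ : ℤ) : ℝ) := by
  have hxej := (mem_box_iff.1 hxe) μ
  rw [Pi.add_apply, Pi.single_eq_same] at hxej
  have h0 : ∀ j, j ≠ μ → (refl n M μ (x + Pi.single μ 1) - x) j = 0 := fun j hj => by
    rw [Pi.sub_apply, refl_apply_ne _ hj, Pi.add_apply, Pi.single_apply, if_neg hj, add_zero, sub_self]
  have hμ : (refl n M μ (x + Pi.single μ 1) - x) μ = 2 * ((n : ℤ) * (M μ : ℤ)) - 2 - 2 * x μ := by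
    rw [Pi.sub_apply, refl_apply_same, Pi.add_apply, Pi.single_eq_same]; ring
  rw [supNorm_eq_of_single h0, hμ, abs_of_nonneg (by linarith)]
  simp only [Int.cast_sub, Int.cast_mul, Int.cast_ofNat]

/-- a box point whose forward `μ`-bond leaves the box lies on the last `μ`-layer. [folklore] -/
theorem last_layer_of_not_mem {x : Fin (d + 1) → ℤ} (hx : x ∈ boxDom (fun i => n * M i))
    (hxe : x + Pi.single μ 1 ∉ boxDom (fun i => n * M i)) : x μ = (n : ℤ) * (M μ : ℤ) - 1 := by
  have hxb := mem_box_iff.1 hx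
  rw [mem_box_iff] at hxe
  push Not at hxe
  obtain ⟨j, hj⟩ := hxe
  by_cases hjμ : j = μ
  · subst hjμ
    rw [Pi.add_apply, Pi.single_eq_same] at hj
    have := hj (by linarith [(hxb j).1])
    linarith [(hxb j).2]
  · rw [Pi.add_apply, Pi.single_apply, if_neg hjμ, add_zero] at hj
    exact absurd (hj (hxb j).1) (not_le.2 (hxb j).2)

/-- the distance from a point of the last `μ`-layer to a bond start `x′` is at least `nM_μ − 1 − x′_μ`.
[folklore] -/
theorem layer_dist_le_supNorm {x x' : Fin (d + 1) → ℤ} (hx : x μ = (n : ℤ) * (M μ : ℤ) - 1) :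
    (((n : ℤ) * (M μ : ℤ) : ℤ) : ℝ) - 1 - ((x' μ : ℤ) : ℝ) ≤ supNorm (x - x') := by
  refine le_trans ?_ (abs_le_supNorm (x - x') μ)
  rw [Pi.sub_apply, hx]
  have : (((n : ℤ) * (M μ : ℤ) - 1 - x' μ : ℤ) : ℝ) ≤ ((|(n : ℤ) * (M μ : ℤ) - 1 - x' μ| : ℤ) : ℝ) := by
    exact_mod_cast le_abs_self _
  simpa [Int.cast_sub, Int.cast_one] using this

variable {ℓ : ℕ} {m2plus : ℝ}

/-- the doubled box has sides `≥ 1`. [folklore] -/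
theorem one_le_dbl (i : BoxInst d ℓ m2plus) (μ j : Fin (d + 1)) : 1 ≤ dbl i.M μ j := by
  by_cases hj : j = μ
  · subst hj; rw [dbl_same]; linarith [i.hM j]
  · rw [dbl_ne hj]; exact i.hM j

/-- **HÖLDER CONTINUITY OF `D_μG_k(□,0)f` UP TO THE FAR `μ`-FACE** (where the Neumann condition makes it vanish):
ONE pair `(δ₀, c₀)` for the whole box family such that for every member, direction `μ`, source `f` and bond
`⟨x, x + e_μ⟩` of `□`,
`|(D_μG_k(□,0)f)(x)| ≤ c₀·(η·(nM_μ − 1 − x_μ))^α·e^{−δ₀dist_η(x, supp f)}‖f‖_∞`,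
`nM_μ − 1 − x_μ ≥ 1` the number of layers between `x` and the far `μ`-face — the printed (1.9) on the DOUBLED box
`□₂` (node 10, `B4Thm19ZeroBoxHolder`) for the bond and its mirror image, whose difference quotient of
`G_k(□₂,0)(f∘fold) = (G_k(□,0)f)∘fold` is `−2(D_μG_k(□,0)f)(x)` at distance `2(nM_μ − 1 − x_μ)`.
[cite: Balaban1983RegularityDecay, Theorem p. 573 (1.9) with p. 584 (2.42), case A = 0, Ω a box, 0 ≤ α < 1] -/
theorem fdiff_face_bound (hℓ : 1 ≤ ℓ) (a : ℝ) (ha : 0 < a) (α : ℝ) (hα0 : 0 ≤ α) (hα1 : α < 1) :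
    ∃ δ₀ c₀ : ℝ, 0 < δ₀ ∧ 0 < c₀ ∧ ∀ (i : BoxInst d ℓ m2plus) (μ : Fin (d + 1)) (f : ↥i.toZF.R → ℝ)
      (x : ↥i.toZF.R) (hx : x.1 + uvec μ ∈ i.toZF.R),
      |fdiff i.toZF.n i.toZF.R μ ((i.toZF.green a).mulVec f) x|
        ≤ c₀ * (((((((ℓ + 1) ^ i.k : ℕ) : ℤ) * (i.M μ : ℤ) : ℤ) : ℝ) - 1 - ((x.1 μ : ℤ) : ℝ))
              / (((ℓ + 1) ^ i.k : ℕ) : ℝ)) ^ α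
          * Real.exp (-(δ₀ * setDist (edistR i.toZF.n i.toZF.R) {x} (supp f))) * i.toZF.supN f := by
  obtain ⟨δ₀, c₀, hδ, hc, h⟩ := thm19_zero_box_holder_value_coeff d ℓ hℓ a a m2plus ha α hα0 hα1
  refine ⟨δ₀, c₀ * Real.exp δ₀, hδ, by positivity, fun i μ f x hx => ?_⟩
  have hn : 1 ≤ (ℓ + 1) ^ i.k := BoxInst.one_le_Lk ℓ i.k
  have hL := Lk_pos ℓ i.k
  have hxR : x.1 ∈ boxDom (fun j => (ℓ + 1) ^ i.k * i.M j) := x.2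
  have hxeR : x.1 + Pi.single μ 1 ∈ boxDom (fun j => (ℓ + 1) ^ i.k * i.M j) := hx
  -- the bond, its mirror image, and the folded source on the doubled box
  set p : ↥(boxDom (fun j => (ℓ + 1) ^ i.k * dbl i.M μ j)) := ⟨x.1, mem_dbl_of_mem hxR⟩
  set pe : ↥(boxDom (fun j => (ℓ + 1) ^ i.k * dbl i.M μ j)) := ⟨x.1 + Pi.single μ 1, mem_dbl_of_mem hxeR⟩
  set p' : ↥(boxDom (fun j => (ℓ + 1) ^ i.k * dbl i.M μ j)) :=
    ⟨refl ((ℓ + 1) ^ i.k) i.M μ (x.1 + Pi.single μ 1), refl_mem_dbl_of_mem hxeR⟩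
  set pe' : ↥(boxDom (fun j => (ℓ + 1) ^ i.k * dbl i.M μ j)) :=
    ⟨refl ((ℓ + 1) ^ i.k) i.M μ x.1, refl_mem_dbl_of_mem hxR⟩
  have hpe : pe.1 = p.1 + Pi.single μ 1 := rfl
  have hpe' : pe'.1 = p'.1 + Pi.single μ 1 := by
    show refl ((ℓ + 1) ^ i.k) i.M μ x.1 = refl ((ℓ + 1) ^ i.k) i.M μ (x.1 + Pi.single μ 1) + Pi.single μ 1
    funext j
    by_cases hj : j = μ
    · subst hj
      rw [Pi.add_apply, refl_apply_same, refl_apply_same, Pi.add_apply, Pi.single_eq_same]; ring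
    · rw [Pi.add_apply, refl_apply_ne _ hj, refl_apply_ne _ hj, Pi.add_apply, Pi.single_apply, if_neg hj,
        add_zero, add_zero]
  have hne : p'.1 ≠ p.1 := refl_ne_of_mem hxR hxeR
  obtain ⟨v, hv⟩ : ∃ v : ↥(boxDom (fun j => (ℓ + 1) ^ i.k * dbl i.M μ j)) → ℝ,
      ∀ z, v z = f (foldPt ((ℓ + 1) ^ i.k) i.M μ z) := ⟨_, fun z => rfl⟩
  have hF : ∀ z, |v z| ≤ i.toZF.supN f := fun z => by rw [hv z]; exact abs_le_supN i.toZF f _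
  have hD : ∀ z, v z ≠ 0 →
      (((ℓ + 1) ^ i.k : ℕ) : ℝ) * setDist (edistR i.toZF.n i.toZF.R) {x} (supp f) - 1
        ≤ min (supNorm (p.1 - z.1)) (supNorm (p'.1 - z.1)) := by
    intro z hz
    rw [hv z] at hz
    have h1 := D1_le i f x (foldPt ((ℓ + 1) ^ i.k) i.M μ z) hz
    rw [foldPt_val] at h1
    refine le_min ?_ ?_
    · have h2 := supNorm_sub_fold_le (μ := μ) hxR z.2
      show _ ≤ supNorm (x.1 - z.1)
      linarith
    · have h2 := supNorm_sub_fold_le_refl (μ := μ) hxR hxeR z.2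
      show _ ≤ supNorm (refl ((ℓ + 1) ^ i.k) i.M μ (x.1 + Pi.single μ 1) - z.1)
      linarith
  have key := h i.k i.hk a i.m2 le_rfl le_rfl i.hm i.hm' (dbl i.M μ) (one_le_dbl i μ)
    v (i.toZF.supN f) _ hF μ p pe p' pe' hpe hpe' hne hD
  rw [green_fold_apply hn ha i.hm f v hv pe', green_fold_apply hn ha i.hm f v hv p',
    green_fold_apply hn ha i.hm f v hv pe, green_fold_apply hn ha i.hm f v hv p] at key
  have e1 : foldPt ((ℓ + 1) ^ i.k) i.M μ p = x := Subtype.ext (fold_of_mem hxR)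
  have e2 : foldPt ((ℓ + 1) ^ i.k) i.M μ pe = nbr x hx := Subtype.ext (fold_of_mem hxeR)
  have e3 : foldPt ((ℓ + 1) ^ i.k) i.M μ p' = nbr x hx := Subtype.ext (fold_refl_of_mem hxeR)
  have e4 : foldPt ((ℓ + 1) ^ i.k) i.M μ pe' = x := Subtype.ext (fold_refl_of_mem hxR)
  rw [e1, e2, e3, e4] at key
  have hw : supNorm (p'.1 - p.1)
      = 2 * ((((((ℓ + 1) ^ i.k : ℕ) : ℤ) * (i.M μ : ℤ) : ℤ) : ℝ) - 1 - ((x.1 μ : ℤ) : ℝ)) := by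
    show supNorm (refl ((ℓ + 1) ^ i.k) i.M μ (x.1 + Pi.single μ 1) - x.1) = _
    rw [supNorm_refl_sub hxeR]; ring
  rw [hw] at key
  have hnn : (i.toZF.n : ℝ) = (((ℓ + 1) ^ i.k : ℕ) : ℝ) := by rw [BoxInst.toZF_n]
  rw [fdiff_eq _ x hx, hnn, BoxInst.green_eq]
  -- abbreviate and finish with real arithmetic
  have hxej := (mem_box_iff.1 hxeR) μ
  rw [Pi.add_apply, Pi.single_eq_same] at hxej
  have hj1 : (1 : ℝ) ≤ (((((ℓ + 1) ^ i.k : ℕ) : ℤ) * (i.M μ : ℤ) : ℤ) : ℝ) - 1 - ((x.1 μ : ℤ) : ℝ) := by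
    have : x.1 μ + 2 ≤ (((ℓ + 1) ^ i.k : ℕ) : ℤ) * (i.M μ : ℤ) := by linarith [hxej.2]
    have := (Int.cast_le (R := ℝ)).2 this
    simp only [Int.cast_add, Int.cast_ofNat] at this
    linarith
  set L : ℝ := (((ℓ + 1) ^ i.k : ℕ) : ℝ) with hLdef
  set j : ℝ := (((((ℓ + 1) ^ i.k : ℕ) : ℤ) * (i.M μ : ℤ) : ℤ) : ℝ) - 1 - ((x.1 μ : ℤ) : ℝ) with hjdef
  set s : ℝ := setDist (edistR i.toZF.n i.toZF.R) {x} (supp f) with hsdef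
  set G := (boxOpR ((ℓ + 1) ^ i.k) a i.m2 i.M)⁻¹ *ᵥ f with hGdef
  set F := i.toZF.supN f with hFdef
  have hF0 : 0 ≤ F := supN_nonneg i.toZF f
  have hj0 : 0 < j := by linarith
  have e : L * ((G x - G (nbr x hx)) - (G (nbr x hx) - G x)) = -(2 * (L * (G (nbr x hx) - G x))) := by ring
  have key2 : (L / (2 * j)) ^ α * |L * ((G x - G (nbr x hx)) - (G (nbr x hx) - G x))|
      ≤ c₀ * Real.exp (-(δ₀ * (L * s - 1) / L)) * F := key
  rw [e, abs_neg, abs_mul, abs_two] at key2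
  have hA : 0 ≤ (j / L) ^ α := Real.rpow_nonneg (div_nonneg hj0.le hL.le) α
  have hhalf : (1 : ℝ) / 2 ≤ (1 / 2 : ℝ) ^ α := by
    have := Real.rpow_le_rpow_of_exponent_ge (by norm_num : (0 : ℝ) < 1 / 2) (by norm_num : (1 : ℝ) / 2 ≤ 1)
      hα1.le
    rwa [Real.rpow_one] at this
  have h2 : 1 ≤ 2 * ((L / (2 * j)) ^ α * (j / L) ^ α) := by
    rw [← Real.mul_rpow (div_nonneg hL.le (by linarith)) (div_nonneg hj0.le hL.le)]
    have e' : L / (2 * j) * (j / L) = 1 / 2 := by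
      field_simp
    rw [e']
    linarith
  have hexp : Real.exp (-(δ₀ * (L * s - 1) / L)) ≤ Real.exp δ₀ * Real.exp (-(δ₀ * s)) := by
    rw [← Real.exp_add]
    apply Real.exp_le_exp.2
    have e' : -(δ₀ * (L * s - 1) / L) = -(δ₀ * s) + δ₀ / L := by
      field_simp
      ring
    rw [e']
    have hL1 : (1 : ℝ) ≤ L := by rw [hLdef]; exact_mod_cast hn
    have : δ₀ / L ≤ δ₀ := div_le_self hδ.le hL1
    linarith
  calc |L * (G (nbr x hx) - G x)| = |L * (G (nbr x hx) - G x)| * 1 := (mul_one _).symm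
    _ ≤ |L * (G (nbr x hx) - G x)| * (2 * ((L / (2 * j)) ^ α * (j / L) ^ α)) :=
        mul_le_mul_of_nonneg_left h2 (abs_nonneg _)
    _ = (j / L) ^ α * ((L / (2 * j)) ^ α * (2 * |L * (G (nbr x hx) - G x)|)) := by ring
    _ ≤ (j / L) ^ α * (c₀ * Real.exp (-(δ₀ * (L * s - 1) / L)) * F) := mul_le_mul_of_nonneg_left key2 hA
    _ ≤ (j / L) ^ α * (c₀ * (Real.exp δ₀ * Real.exp (-(δ₀ * s))) * F) :=
        mul_le_mul_of_nonneg_left (mul_le_mul_of_nonneg_right (mul_le_mul_of_nonneg_left hexp hc.le) hF0) hA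
    _ = c₀ * Real.exp δ₀ * (j / L) ^ α * Real.exp (-(δ₀ * s)) * F := by ring

end Face

/-! ## §4 The unguarded Hölder quotient of b04's carrier on boxes -/

section Carrier

variable {n : ℕ} {M : Fin (d + 1) → ℕ} {μ : Fin (d + 1)}

/-- a bond start is at least one layer before the far `μ`-face. [folklore] -/
theorem one_le_layers {x : Fin (d + 1) → ℤ} (hxe : x + Pi.single μ 1 ∈ boxDom (fun i => n * M i)) :
    (1 : ℝ) ≤ (((n : ℤ) * (M μ : ℤ) : ℤ) : ℝ) - 1 - ((x μ : ℤ) : ℝ) := by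
  have hxej := (mem_box_iff.1 hxe) μ
  rw [Pi.add_apply, Pi.single_eq_same] at hxej
  have : x μ + 2 ≤ (n : ℤ) * (M μ : ℤ) := by linarith [hxej.2]
  have := (Int.cast_le (R := ℝ)).2 this
  simp only [Int.cast_add, Int.cast_ofNat] at this
  linarith

/-- monotonicity of the set distance in the first set. [folklore] -/
theorem setDist_mono_left {β : Type*} (dR : β → β → ℝ) {A A' B : Finset β} (hA : A ⊆ A')
    (hne : A.Nonempty) : setDist dR A' B ≤ setDist dR A B := by
  by_cases hAB : (A ×ˢ B).Nonempty
  · have e : setDist dR A B = (A ×ˢ B).inf' hAB (fun q => dR q.1 q.2) := by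
      unfold setDist; rw [dif_pos hAB]
    rw [e]
    exact Finset.le_inf' _ _ fun q hq =>
      setDist_le dR (hA (Finset.mem_product.1 hq).1) (Finset.mem_product.1 hq).2
  · have hB : ¬B.Nonempty := fun hB => hAB (hne.product hB)
    have hAB' : ¬(A' ×ˢ B).Nonempty := fun h => hB (Finset.nonempty_product.1 h).2
    have e : setDist dR A B = 0 := by unfold setDist; rw [dif_neg hAB]
    have e' : setDist dR A' B = 0 := by unfold setDist; rw [dif_neg hAB']
    rw [e, e']

/-- monotonicity of the printed bound `c·e^{−δs}·F` in the constants. [folklore] -/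
theorem weaken {c c' δ δ' s F P : ℝ} (hc : c ≤ c') (hδ : δ' ≤ δ) (hc0 : 0 ≤ c) (hs : 0 ≤ s) (hF : 0 ≤ F)
    (h : P ≤ c * Real.exp (-(δ * s)) * F) : P ≤ c' * Real.exp (-(δ' * s)) * F := by
  refine h.trans ?_
  have he : Real.exp (-(δ * s)) ≤ Real.exp (-(δ' * s)) :=
    Real.exp_le_exp.2 (by nlinarith [mul_le_mul_of_nonneg_right hδ hs])
  exact mul_le_mul_of_nonneg_right (mul_le_mul hc he (Real.exp_pos _).le (hc0.trans hc)) hF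

/-- **ABSORBING THE HÖLDER WEIGHT AT THE FACE**: if `|D_μGf(y)| ≤ c(j/L)^α e^{−δs}F` with `j ≥ 1` layers to the far
face and the other point is at sup-distance `D ≥ j`, then `(D/L)^{−α}|D_μGf(y)| ≤ c e^{−δs′}F` for every `s′ ≤ s`.
[folklore] -/
theorem weight_absorb {L j α c c' δ δ' s s' F D P : ℝ} (hL : 0 < L) (hj : 1 ≤ j) (hα : 0 ≤ α)
    (hc : 0 ≤ c) (hcc : c ≤ c') (hF : 0 ≤ F) (hδ' : 0 ≤ δ') (hδδ : δ' ≤ δ) (hjD : j ≤ D) (hs0 : 0 ≤ s')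
    (hs : s' ≤ s) (hP : P ≤ c * (j / L) ^ α * Real.exp (-(δ * s)) * F) (hP0 : 0 ≤ P) :
    (1 / L * D) ^ (-α) * P ≤ c' * Real.exp (-(δ' * s')) * F := by
  have hjL : 0 < j / L := div_pos (by linarith) hL
  have hw : (1 / L * D) ^ (-α) ≤ (j / L) ^ (-α) := by
    refine Real.rpow_le_rpow_of_nonpos hjL ?_ (by linarith)
    calc j / L = 1 / L * j := by ring
      _ ≤ 1 / L * D := mul_le_mul_of_nonneg_left hjD (by positivity)
  have hA' : 0 ≤ (j / L) ^ (-α) := Real.rpow_nonneg hjL.le _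
  have hAA : (j / L) ^ (-α) * (j / L) ^ α = 1 := by
    rw [Real.rpow_neg hjL.le, inv_mul_cancel₀ (Real.rpow_pos_of_pos hjL α).ne']
  have he : Real.exp (-(δ * s)) ≤ Real.exp (-(δ' * s')) :=
    Real.exp_le_exp.2 (by nlinarith [mul_le_mul_of_nonneg_left hs hδ', mul_le_mul_of_nonneg_right hδδ (hs0.trans hs)])
  calc (1 / L * D) ^ (-α) * P ≤ (j / L) ^ (-α) * (c * (j / L) ^ α * Real.exp (-(δ * s)) * F) :=
        mul_le_mul hw hP hP0 hA'
    _ = ((j / L) ^ (-α) * (j / L) ^ α) * (c * Real.exp (-(δ * s)) * F) := by ring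
    _ = c * Real.exp (-(δ * s)) * F := by rw [hAA, one_mul]
    _ ≤ c' * Real.exp (-(δ' * s')) * F :=
        mul_le_mul_of_nonneg_right (mul_le_mul hcc he (Real.exp_pos _).le (hc.trans hcc)) hF

variable {ℓ : ℕ} {m2plus : ℝ}

/-- **CLAUSE (1.9) AT `A = 0` ON EVERY BOX, UNGUARDED** — b04's verbatim Hölder field `lhs19` of
`zeroFieldSettingB`: for `0 ≤ α < 1`, ONE pair `(δ₀, c₀)` for the whole box family such that for every member,
direction `μ`, source `f` and ALL points `x, x′` of the box,
`|x − x′|_η^{−α}|(D_μG_k(□,0)f)(x′) − (D_μG_k(□,0)f)(x)| ≤ c₀e^{−δ₀dist_η({x,x′}, supp f)}‖f‖_∞`,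
where `D_μ` is b04's `fdiff` (`0` on a non-bond): both bonds in `□` — node 12 (`B4Ineq19ZeroBoxEta.lhs19_bound`,
from node 10); exactly one bond in `□` — the other point lies on the far `μ`-face, at sup-distance at least the
number of layers `j` from the bond to that face, and the face bound `fdiff_face_bound` (`∝ (ηj)^α`) absorbs the
weight `≤ (ηj)^{−α}`; no bond — the quotient is `0`.
[cite: Balaban1983RegularityDecay, Theorem p. 573 (1.9) «for rectangular parallelepipeds … without any
restrictions on the points x, x′», with p. 584 (2.42), case A = 0, 0 ≤ α < 1] -/
theorem lhs19B_bound (hℓ : 1 ≤ ℓ) (a : ℝ) (ha : 0 < a) (α : ℝ) (hα0 : 0 ≤ α) (hα1 : α < 1) :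
    ∃ δ₀ c₀ : ℝ, 0 < δ₀ ∧ 0 < c₀ ∧ ∀ (i : BoxInst d ℓ m2plus) (μ : Fin (d + 1)) (f : ↥i.toZF.R → ℝ)
      (x x' : ↥i.toZF.R),
      edistR i.toZF.n i.toZF.R x x' ^ (-α) *
          |fdiff i.toZF.n i.toZF.R μ ((i.toZF.green a).mulVec f) x'
            - fdiff i.toZF.n i.toZF.R μ ((i.toZF.green a).mulVec f) x|
        ≤ c₀ * Real.exp (-(δ₀ * setDist (edistR i.toZF.n i.toZF.R) ({x} ∪ {x'}) (supp f))) * i.toZF.supN f := by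
  obtain ⟨δ₁, c₁, hδ₁, hc₁, h₁⟩ := lhs19_bound (d := d) (m2plus := m2plus) hℓ a ha α hα0 hα1
  obtain ⟨δ₂, c₂, hδ₂, hc₂, h₂⟩ := fdiff_face_bound (d := d) (m2plus := m2plus) hℓ a ha α hα0 hα1
  refine ⟨min δ₁ δ₂, max c₁ c₂, lt_min hδ₁ hδ₂, lt_max_of_lt_left hc₁, fun i μ f x x' => ?_⟩
  have hL := Lk_pos ℓ i.k
  have hF := supN_nonneg i.toZF f
  have hs := setDist_edistR_nonneg (n := i.toZF.n) ({x} ∪ {x'}) (supp f)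
  have h0 := rhs_nonneg (c := max c₁ c₂) (δ := min δ₁ δ₂)
    (s := setDist (edistR i.toZF.n i.toZF.R) ({x} ∪ {x'}) (supp f)) (le_max_of_le_left hc₁.le) i.toZF f
  have hxR : x.1 ∈ boxDom (fun j => (ℓ + 1) ^ i.k * i.M j) := x.2
  have hx'R : x'.1 ∈ boxDom (fun j => (ℓ + 1) ^ i.k * i.M j) := x'.2
  have hs₁ : setDist (edistR i.toZF.n i.toZF.R) ({x} ∪ {x'}) (supp f)
      ≤ setDist (edistR i.toZF.n i.toZF.R) {x} (supp f) :=
    setDist_mono_left _ Finset.subset_union_left (Finset.singleton_nonempty x)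
  have hs₂ : setDist (edistR i.toZF.n i.toZF.R) ({x} ∪ {x'}) (supp f)
      ≤ setDist (edistR i.toZF.n i.toZF.R) {x'} (supp f) :=
    setDist_mono_left _ Finset.subset_union_right (Finset.singleton_nonempty x')
  by_cases hx : x.1 + uvec μ ∈ i.toZF.R <;> by_cases hx' : x'.1 + uvec μ ∈ i.toZF.R
  · -- both bonds in the box: node 12
    have key := h₁ i μ f x x'
    rw [holderQ_of_bond α _ hx hx'] at key
    exact weaken (le_max_left _ _) (min_le_left _ _) hc₁.le hs hF key
  · -- `x` a bond start, `x′` on the far face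
    have hx'e : x'.1 + Pi.single μ 1 ∉ boxDom (fun j => (ℓ + 1) ^ i.k * i.M j) := hx'
    have hxe : x.1 + Pi.single μ 1 ∈ boxDom (fun j => (ℓ + 1) ^ i.k * i.M j) := hx
    have hlast := last_layer_of_not_mem hx'R hx'e
    have hjD := layer_dist_le_supNorm (x' := x.1) hlast
    have hj1 := one_le_layers hxe
    have hb := h₂ i μ f x hx
    have hed : edistR i.toZF.n i.toZF.R x x'
        = 1 / (((ℓ + 1) ^ i.k : ℕ) : ℝ) * supNorm (x'.1 - x.1) := by
      unfold edistR; rw [BoxInst.toZF_n, supNorm_sub_comm x.1 x'.1]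
    rw [fdiff_of_not_mem _ hx', zero_sub, abs_neg, hed]
    exact weight_absorb hL hj1 hα0 hc₂.le (le_max_right _ _) hF (lt_min hδ₁ hδ₂).le (min_le_right _ _) hjD
      hs hs₁ hb (abs_nonneg _)
  · -- `x′` a bond start, `x` on the far face
    have hxe : x.1 + Pi.single μ 1 ∉ boxDom (fun j => (ℓ + 1) ^ i.k * i.M j) := hx
    have hx'e : x'.1 + Pi.single μ 1 ∈ boxDom (fun j => (ℓ + 1) ^ i.k * i.M j) := hx'
    have hlast := last_layer_of_not_mem hxR hxe
    have hjD := layer_dist_le_supNorm (x' := x'.1) hlast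
    have hj1 := one_le_layers hx'e
    have hb := h₂ i μ f x' hx'
    have hed : edistR i.toZF.n i.toZF.R x x'
        = 1 / (((ℓ + 1) ^ i.k : ℕ) : ℝ) * supNorm (x.1 - x'.1) := by
      unfold edistR; rw [BoxInst.toZF_n]
    rw [fdiff_of_not_mem _ hx, sub_zero, hed]
    exact weight_absorb hL hj1 hα0 hc₂.le (le_max_right _ _) hF (lt_min hδ₁ hδ₂).le (min_le_right _ _) hjD
      hs hs₂ hb (abs_nonneg _)
  · -- no bond: the quotient vanishes
    rw [fdiff_of_not_mem _ hx, fdiff_of_not_mem _ hx', sub_zero, abs_zero, mul_zero]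
    exact h0

end Carrier

/-! ## §5 `B4.Ineq19_110` VERBATIM on b04's carrier `zeroFieldSettingB` over the box family -/

section Main

variable {ℓ : ℕ} {m2plus : ℝ}

/-- **B4's THEOREM p. 573, CLAUSES (1.9)–(1.10) — the cell's typed `B4.Ineq19_110` — AT `A = 0` ON b04's VERBATIM
ZERO-FIELD CARRIER `zeroFieldSettingB` OVER THE BOX FAMILY** (`boxFamB`, node 12), for every `0 ≤ α < 1`: ONE pair
of positive constants `(δ₀, c₀)` (depending on `d`, `L = ℓ + 1`, `a`, `m²₊`, `α` — «independent of A, k, Ω») such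
that for EVERY threshold `R₀` and EVERY member `i`, `Ineq19_110 (boxFamB … i) α δ₀ c₀ R₀` holds — with b04's
UNGUARDED Hölder field `lhs19` (no bond convention: `D_μ = fdiff` is `0` on a non-bond and the quotient is formed for
ALL `x, x′ ∈ □`), the (1.10) fields `valDG`, `valG` as in node 12.  The typed antecedent `rect ∨ R₀ ≤ dist(·, Ω₀∖Ω)`
is not used.  Assembled from §4 (`lhs19B_bound`) and node 12 (`valDG_bound`, `valG_bound`).
[cite: Balaban1983RegularityDecay, Theorem p. 573 (1.9)–(1.10) «for rectangular parallelepipeds … without any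
restrictions on the points x, x′», case A = 0, Ω a box, 0 ≤ α < 1] -/
theorem ineq19_110_boxFamB (hℓ : 1 ≤ ℓ) (a : ℝ) (ha : 0 < a) (Mb : ℕ)
    (g : ∀ i : ZeroFieldInstance d, (↥i.R → ℝ) → ℝ) (α : ℝ) (hα0 : 0 ≤ α) (hα1 : α < 1) :
    ∃ δ₀ c₀ : ℝ, 0 < δ₀ ∧ 0 < c₀ ∧ ∀ (R₀ : ℝ) (i : BoxInst d ℓ m2plus),
      Ineq19_110 (boxFamB ℓ m2plus a Mb g i) α δ₀ c₀ R₀ := by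
  obtain ⟨δ₁, c₁, hδ₁, hc₁, h₁⟩ := lhs19B_bound (d := d) (m2plus := m2plus) hℓ a ha α hα0 hα1
  obtain ⟨δ₂, c₂, hδ₂, hc₂, h₂⟩ := B4Ineq19ZeroBoxEta.valDG_bound (d := d) (m2plus := m2plus) hℓ a ha
  obtain ⟨δ₃, c₃, hδ₃, hc₃, h₃⟩ := B4Ineq19ZeroBoxEta.valG_bound (d := d) (m2plus := m2plus) hℓ a ha
  refine ⟨min δ₁ (min δ₂ δ₃), max c₁ (max c₂ c₃), lt_min hδ₁ (lt_min hδ₂ hδ₃),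
    lt_max_of_lt_left hc₁, fun R₀ i => (ineq19_110_B_iff a Mb g i.toZF _ _ _ _).2
      ⟨fun μ f x x' _ => ?_, fun μ f x _ => ⟨?_, ?_⟩⟩⟩
  · exact weaken (le_max_left _ _) (min_le_left _ _) hc₁.le
      (setDist_edistR_nonneg ({x} ∪ {x'}) (supp f)) (supN_nonneg i.toZF f) (h₁ i μ f x x')
  · exact weaken ((le_max_left _ _).trans (le_max_right _ _)) ((min_le_right _ _).trans (min_le_left _ _))
      hc₂.le (setDist_edistR_nonneg {x} (supp f)) (supN_nonneg i.toZF f) (h₂ i μ f x)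
  · exact weaken ((le_max_right _ _).trans (le_max_right _ _)) ((min_le_right _ _).trans (min_le_right _ _))
      hc₃.le (setDist_edistR_nonneg {x} (supp f)) (supN_nonneg i.toZF f) (h₃ i f x)

/-- **THE LEAF HALF `ThmPrinted19NN` (node 12: the typed leaf `B4.ThmPrinted` restricted to (1.9)–(1.10) and to
`0 ≤ α < 1`) HOLDS ON b04's VERBATIM CARRIER OVER THE BOX FAMILY** — unconditionally in the member (the typed
antecedents `regular`, `bigBlocks`, `0 < e ≤ e₁` are not used; `R₀`, `e₁` witnessed by `1`).
[cite: Balaban1983RegularityDecay, Theorem p. 573 (1.9)–(1.10), case A = 0, Ω a box, 0 ≤ α < 1] -/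
theorem thmPrinted19NN_boxFamB (hℓ : 1 ≤ ℓ) (a : ℝ) (ha : 0 < a) (Mb : ℕ)
    (g : ∀ i : ZeroFieldInstance d, (↥i.R → ℝ) → ℝ) :
    ThmPrinted19NN (boxFamB (d := d) ℓ m2plus a Mb g) := by
  intro α hα0 hα1
  obtain ⟨δ₀, c₀, hδ, hc, h⟩ := ineq19_110_boxFamB (m2plus := m2plus) hℓ a ha Mb g α hα0 hα1
  exact ⟨δ₀, c₀, 1, 1, hδ, hc, one_pos, one_pos, fun i _ _ _ _ => h 1 i⟩

/-- the same for b04's DEFAULT carrier `B4Cor23ZeroEta.zeroFieldSetting a Mb` (boundary assignment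
`dist_η(supp f, Ω₀∖Ω)`) read on the box instances — no field re-read at all. [folklore] -/
theorem thmPrinted19NN_zeroFieldSetting (hℓ : 1 ≤ ℓ) (a : ℝ) (ha : 0 < a) (Mb : ℕ) :
    ThmPrinted19NN (fun i : BoxInst d ℓ m2plus => zeroFieldSetting a Mb i.toZF) :=
  thmPrinted19NN_boxFamB hℓ a ha Mb _

/-- **AGREEMENT OF THE TWO READINGS ON BOXES**: on the box family, b04's unguarded carrier (`boxFamB`) and node 12's
bond-convention carrier (`boxFam`) BOTH satisfy the typed (1.9)–(1.10) for `0 ≤ α < 1` with common constants.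
[folklore] -/
theorem ineq19_110_boxFam_and_boxFamB (hℓ : 1 ≤ ℓ) (a : ℝ) (ha : 0 < a) (Mb : ℕ)
    (g : ∀ i : ZeroFieldInstance d, (↥i.R → ℝ) → ℝ) (α : ℝ) (hα0 : 0 ≤ α) (hα1 : α < 1) :
    ∃ δ₀ c₀ : ℝ, 0 < δ₀ ∧ 0 < c₀ ∧ ∀ (R₀ : ℝ) (i : BoxInst d ℓ m2plus),
      Ineq19_110 (boxFam ℓ m2plus a Mb g i) α δ₀ c₀ R₀ ∧ Ineq19_110 (boxFamB ℓ m2plus a Mb g i) α δ₀ c₀ R₀ := by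
  obtain ⟨δ₁, c₁, hδ₁, hc₁, h₁⟩ := ineq19_110_boxFam (d := d) (m2plus := m2plus) hℓ a ha Mb g α hα0 hα1
  obtain ⟨δ₂, c₂, hδ₂, hc₂, h₂⟩ := ineq19_110_boxFamB (d := d) (m2plus := m2plus) hℓ a ha Mb g α hα0 hα1
  refine ⟨min δ₁ δ₂, max c₁ c₂, lt_min hδ₁ hδ₂, lt_max_of_lt_left hc₁, fun R₀ i => ⟨?_, ?_⟩⟩
  · refine (ineq19_110_bond_iff a Mb g i.toZF _ _ _ _).2 ⟨fun μ f x x' hh => ?_, fun μ f x hh => ⟨?_, ?_⟩⟩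
    · exact weaken (le_max_left _ _) (min_le_left _ _) hc₁.le (setDist_edistR_nonneg _ _)
        (supN_nonneg i.toZF f) (((ineq19_110_bond_iff a Mb g i.toZF _ _ _ _).1 (h₁ R₀ i)).1 μ f x x' hh)
    · exact weaken (le_max_left _ _) (min_le_left _ _) hc₁.le (setDist_edistR_nonneg _ _)
        (supN_nonneg i.toZF f) (((ineq19_110_bond_iff a Mb g i.toZF _ _ _ _).1 (h₁ R₀ i)).2 μ f x hh).1
    · exact weaken (le_max_left _ _) (min_le_left _ _) hc₁.le (setDist_edistR_nonneg _ _)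
        (supN_nonneg i.toZF f) (((ineq19_110_bond_iff a Mb g i.toZF _ _ _ _).1 (h₁ R₀ i)).2 μ f x hh).2
  · refine (ineq19_110_B_iff a Mb g i.toZF _ _ _ _).2 ⟨fun μ f x x' hh => ?_, fun μ f x hh => ⟨?_, ?_⟩⟩
    · exact weaken (le_max_right _ _) (min_le_right _ _) hc₂.le (setDist_edistR_nonneg _ _)
        (supN_nonneg i.toZF f) (((ineq19_110_B_iff a Mb g i.toZF _ _ _ _).1 (h₂ R₀ i)).1 μ f x x' hh)
    · exact weaken (le_max_right _ _) (min_le_right _ _) hc₂.le (setDist_edistR_nonneg _ _)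
        (supN_nonneg i.toZF f) (((ineq19_110_B_iff a Mb g i.toZF _ _ _ _).1 (h₂ R₀ i)).2 μ f x hh).1
    · exact weaken (le_max_right _ _) (min_le_right _ _) hc₂.le (setDist_edistR_nonneg _ _)
        (supN_nonneg i.toZF f) (((ineq19_110_B_iff a Mb g i.toZF _ _ _ _).1 (h₂ R₀ i)).2 μ f x hh).2

end Main

/-! ## §6 Non-vacuity: the typed antecedents are met at every scale; the statements are instantiated -/

section NonVacuity

variable {ℓ : ℕ} {m2plus : ℝ}

/-- NON-VACUITY AT EVERY SCALE, in b04's verbatim carrier: for every `e₁ > 0`, every big-block size `Mb ≥ 1` and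
every `k ≥ 1` the member `BoxInst.cube … k … Mb … e₁` (node 12) meets ALL FOUR typed antecedents of the leaf
(`regular`, `bigBlocks`, `0 < e ≤ e₁`), so the threshold «for e sufficiently small» and the big-block hypothesis
exclude no mesh `η = L^{-k}` — the uniformity in `k` certified by `ineq19_110_boxFamB` is exercised. [folklore] -/
theorem cube_hypothesesB (hm2 : 0 ≤ m2plus) (a : ℝ) (g : ∀ i : ZeroFieldInstance d, (↥i.R → ℝ) → ℝ) (k : ℕ)
    (hk : 1 ≤ k) (Mb : ℕ) (hMb : 1 ≤ Mb) {e₁ : ℝ} (he : 0 < e₁) :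
    (boxFamB ℓ m2plus a Mb g (BoxInst.cube ℓ hm2 k hk Mb hMb e₁)).regular ∧
      (boxFamB ℓ m2plus a Mb g (BoxInst.cube ℓ hm2 k hk Mb hMb e₁)).bigBlocks ∧
      0 < (boxFamB ℓ m2plus a Mb g (BoxInst.cube ℓ hm2 k hk Mb hMb e₁)).e ∧
      (boxFamB ℓ m2plus a Mb g (BoxInst.cube ℓ hm2 k hk Mb hMb e₁)).e ≤ e₁ := by
  have hMn : 1 ≤ Mb * (ℓ + 1) ^ k :=
    Nat.one_le_iff_ne_zero.mpr (Nat.mul_ne_zero (by omega) (Nat.pos_iff_ne_zero.mp (Nat.pos_of_ne_zero (by positivity))))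
  have h := boxDom_isBlockUnion (d := d) hMn fun _ => 1
  have e : (fun _ : Fin (d + 1) => Mb * (ℓ + 1) ^ k * 1) = fun _ : Fin (d + 1) => (ℓ + 1) ^ k * Mb := by
    funext; ring
  rw [e] at h
  exact ⟨trivial, ⟨h, h⟩, he, le_rfl⟩

/-- hence, for every threshold `e₁ > 0` and every scale, SOME member meets the antecedents AND satisfies the typed
(1.9)–(1.10) with the family's constants (pattern of `B4Cor23ZeroEta.threshold_met`). [folklore] -/
theorem threshold_metB (hℓ : 1 ≤ ℓ) (hm2 : 0 ≤ m2plus) (a : ℝ) (ha : 0 < a)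
    (g : ∀ i : ZeroFieldInstance d, (↥i.R → ℝ) → ℝ) {Mb : ℕ} (hMb : 1 ≤ Mb) (α : ℝ) (hα0 : 0 ≤ α) (hα1 : α < 1) :
    ∃ δ₀ c₀ : ℝ, 0 < δ₀ ∧ 0 < c₀ ∧ ∀ (k : ℕ), 1 ≤ k → ∀ {e₁ : ℝ}, 0 < e₁ → ∀ R₀ : ℝ,
      ∃ i : BoxInst d ℓ m2plus, i.k = k ∧ (boxFamB ℓ m2plus a Mb g i).regular ∧
        (boxFamB ℓ m2plus a Mb g i).bigBlocks ∧ 0 < (boxFamB ℓ m2plus a Mb g i).e ∧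
        (boxFamB ℓ m2plus a Mb g i).e ≤ e₁ ∧ Ineq19_110 (boxFamB ℓ m2plus a Mb g i) α δ₀ c₀ R₀ := by
  obtain ⟨δ₀, c₀, hδ, hc, h⟩ := ineq19_110_boxFamB (d := d) (m2plus := m2plus) hℓ a ha Mb g α hα0 hα1
  exact ⟨δ₀, c₀, hδ, hc, fun k hk e₁ he R₀ =>
    ⟨BoxInst.cube ℓ hm2 k hk Mb hMb e₁, rfl, (cube_hypothesesB hm2 a g k hk Mb hMb he).1,
      (cube_hypothesesB hm2 a g k hk Mb hMb he).2.1, (cube_hypothesesB hm2 a g k hk Mb hMb he).2.2.1,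
      (cube_hypothesesB hm2 a g k hk Mb hMb he).2.2.2, h R₀ _⟩⟩

/-- the certified statement instantiated: `d + 1 = 4`, `L = 2`, `a = 1`, `m²₊ = 1`, `Mb = 5`, b04's default boundary
assignment, `α = 1/2`. [folklore] -/
example : ∃ δ₀ c₀ : ℝ, 0 < δ₀ ∧ 0 < c₀ ∧ ∀ (R₀ : ℝ) (i : BoxInst 3 1 1),
    Ineq19_110 (boxFamB 1 1 1 5 (fun i f => bdist i.n i.hsub f) i) (1 / 2) δ₀ c₀ R₀ :=
  ineq19_110_boxFamB le_rfl 1 one_pos 5 _ (1 / 2) (by norm_num) (by norm_num)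

/-- the leaf half on b04's default carrier at `d + 1 = 4`, `L = 2`, `a = 1`, `m²₊ = 1`, `Mb = 5`. [folklore] -/
example : ThmPrinted19NN (fun i : BoxInst 3 1 1 => zeroFieldSetting 1 5 i.toZF) :=
  thmPrinted19NN_zeroFieldSetting le_rfl 1 one_pos 5

end NonVacuity

end

end Literature.MathematicalPhysics.QuantumFieldTheory.Balaban1983to89.B4Ineq19ZeroBoxFace
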